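import Summits.Langlands.Langlands.Theses.EisensteinGelfandKirillov
import Summits.Langlands.Langlands.Theses.DyadicOddResidue
import Summits.Langlands.Langlands.Theses.RamifiedCoefficientSeed
import Literature.NumberTheory.GaloisRepresentations.AbsIrreducibleIndexTwo
import Literature.NumberTheory.Automorphic.BCDTModularity
import Literature.FieldTheory.AlgClosed.PadicAlgClEquivComplex
import Literature.NumberTheory.Automorphic.GLnAdelicStructureProofs
import Summits.Langlands.Langlands.Theorems.IrreducibilityBySelfDualityReciprocityUpToIrreducibilityCorrespondsConj
import Literature.NumberTheory.Automorphic.ChebotarevArtinRepHolds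
import Literature.NumberTheory.GaloisRepresentations.FramedRepEquivConj
import Summits.Langlands.Langlands.Theses.EisensteinDegreeShift
import Summits.Langlands.Langlands.Theses.PrimeSwitchSplit

/-!
# Disproof of `SectorComplement` — SHARED work file of the homonymous frame/junction cruxes

This crux directory is shared by every route whose declared complement-of-the-sector item is called
`SectorComplement`.  The file has one PART per item, each by its own disprover seat, each importing its
own route file; parts never assert any crux, target or the summit.

* PART I  — stmt-Langlands-18275, route `EisensteinGelfandKirillov` (`egk_` prefix; cdisprove seat of
  18275, 2026-08-17) — verbatim below.
* PART II — stmt-Langlands-18745, route `DyadicOddResidue` (`dor_` prefix; seat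
  refuter-cdisprove-stmt-Langlands-18745-0, cycle 1, 2026-08-17) — after PART I; its findings index is
  the module docblock headed "PART II" further down.
* PART III — stmt-Langlands-16781, route `RamifiedCoefficientSeed` (`rcs_` prefix, section
  `RamifiedCoefficientSeed`; seat refuter-cdisprove-stmt-Langlands-16781-0, cycle 1, 2026-08-17) — after
  PART II; its findings index is the module docblock headed "PART III" further down.  Extra imports it
  adds at the top of this file: the route file, `AbsIrreducibleIndexTwo` + `BCDTModularity` (residual ⇒
  absolute irreducibility ⇒ descent along `ℚ(ζ_p)/ℚ`), `PadicAlgClEquivComplex` (`ι` exists),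
  `GLnAdelicStructureProofs` (`hcpt` holds), and — for the §R8 stub certificates — `…ReciprocityUpToIrreducibilityCorrespondsConj`
  (change of frame in `Corresponds`), `ChebotarevArtinRepHolds`, `FramedRepEquivConj`.  The PART III seat also REPAIRED one proof term of PART II
  (`dor_sectorComplement_iff_langlands_of_cruxes`: route DyadicOddResidue rev 5 re-typed `closes`, K2 split
  into three cells + glue; statement unchanged, now proved through `dor_target_of_cruxes`) so that the
  shared file elaborates again; PART II's prose "the other four hypotheses of `closes`" predates rev 5.
* PART IV — stmt-Langlands-18372, route `EisensteinDegreeShift` (`eds_` prefix, section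
  `EisensteinDegreeShift`; seat refuter-cdisprove-stmt-Langlands-18372-0, cycle 1, 2026-08-17) — after
  PART III, at the end of the file; its findings index is the module docblock headed "PART IV".  Extra
  imports it adds at the top of this file: the route file and `Theses.PrimeSwitchSplit` (the registered
  line of 18372 is route PrimeSwitchSplit's item set with its weak-(B) crux granted the target; its
  `closes` is reused and its items are named, never asserted).

# PART I — Disproof of `EisensteinGelfandKirillov.SectorComplement` — findings (crux stmt-Langlands-18275)

ITEM. `Summit.Langlands.Langlands.Theses.EisensteinGelfandKirillov.SectorComplement : Prop :=
ReducibleCrystallineModular → _root_.Langlands` (crux rank 9; the route's declared COMPLEMENT OF THE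
SECTOR, a D-0027 §2.2 frame item: "not attacked by this route … trivially implied by `Langlands` …
never staff it from this route").  NB: the crux directory `Cruxes/SectorComplement/` is SHARED with the
homonymous frame items of other routes (stmt-Langlands-12923 SkinnerWilesDefectOne, 14623, 12840, …);
everything in THIS file is about stmt-Langlands-18275 only, hence the `egk_` prefixes.

VERDICT OF THE DISPROVER (cycle 1, 2026-08-17): NO KILL, and none is available short of refuting the
audited summit statement.  Kernel-checked below:

* §1 logical position — `egk_not_sectorComplement_iff : ¬ C ↔ X ∧ ¬ Langlands` (C the crux, X the
  route target `ReducibleCrystallineModular`): a disproof of C is EXACTLY a proof of the open sector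
  theorem X (Fontaine–Mazur for residually reducible, p-distinguished, crystalline HT-regular,
  NON-ordinary `GL₂` over totally real `F`, `p ≥ 5` unramified — known only ordinary
  [SkinnerWiles1999, Zhang2024] or `F_v = ℚ_p` [Pan2022]) TOGETHER WITH a refutation of the formal
  summit `_root_.Langlands` (`egk_not_langlands_of_not_sectorComplement`).
* §2 NEW for this route (not derivable for the sibling SkinnerWilesDefectOne frame, whose sector is
  "ordinary", see `Theorems/SkinnerWilesDefectOneSectorComplement.lean` docstring):
  `egk_target_of_langlands : Langlands → X` — the EGK sector is literally INSIDE the summit as typed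
  (crystalline for Fontaine's pinned datum ⇒ de Rham, `IsCrystallineFramed.isDeRhamFramed`; the
  reciprocity data come from the summit's own non-vacuity conjunct), whence the exact bookkeeping
  identity `egk_langlands_iff_target_and_sectorComplement : Langlands ↔ X ∧ C`.  Consequences for a
  would-be disprover: (i) there is no typing drift between the target's conclusion and direction (B)
  of the summit to exploit (same `SatakeFrobCompatibleAt`, same pinned `D_pst` datum, `0 < 2`);
  (ii) `¬ C → ¬ Langlands` AND `¬ X → ¬ Langlands`-free: refuting X would NOT touch the summit, but
  refuting C is refuting the summit (plus proving X).
* §3 load-bearing analysis — C has ONE hypothesis, X.  `SectorComplementWithoutTarget := Langlands`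
  (C with X dropped) is the summit itself (`egk_sectorComplementWithoutTarget_iff`); the protocol's
  `_false_without_` lemma would be `¬ Langlands` and is NOT available (it would refute the audited
  summit, Statement audit 2026-08-14 / AMBER-4 pin 2026-08-16).  Under the route's other cruxes
  (door/engine/exit) C ↔ Langlands (`egk_sectorComplement_iff_langlands_of_cruxes`), i.e. once items
  18272–18274 land this item IS the summit.
* §4 attacks that are N/A or empty, recorded so nobody repeats them: C has NO binders (an implication
  between two closed Props) ⇒ degenerate-instance / junk-model / quantifier-order / finite-model
  (`decide`) attacks do not exist at C; they live in X (item 18271, vetted by the route-review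
  refuter: typing faithful, hypotheses satisfiable in principle, conclusion type
  `CuspidalAutomorphicRepData 2 F hcpt` has NO junk inhabitant — `AutomorphicRepData` demands stable
  `W' < W ≤ 𝒜₀` with `W/W'` irreducible, so X is not junk-provable) and in `Langlands` (audited).
  Paper probes of the summit's corners flagged by the planner ("irregular π, even ρ") found no typed
  over-claim in the 60-min box: (a) `n = 1` convention check — `π = |·|_𝔸` is L-algebraic (HC
  parameter `1 ∈ ℤ`), Satake parameter `α = q_v⁻¹` under the tree's normalisation
  (`T_{v,1}`-eigenvalue `q^{0}e₁(α)`), predicted arithmetic-Frobenius polynomial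
  `X - ι⁻¹(α⁻¹) = X - q_v` = that of the cyclotomic character, which IS the BG partner of `|·|`
  (geometric Frobenius ↔ uniformiser) — consistent; (b) even irreducible geometric `ρ` (n = 2, F = ℚ):
  direction (B) asks for an L-algebraic CUSPIDAL `π` — the weight-0 Maass newform (HC parameter
  `{0,0}`, integral) is a Borel–Jacquet automorphic form, so (B) is the Artin/Langlands conjecture
  there, not an over-claim; (c) irregular L-algebraic cuspidal `π` in (A) (weight 1, Maass `λ = 1/4`):
  Galois representations conjectured (Deligne–Serre known / Artin open) — again the conjecture, not an
  artefact; (d) uniqueness clause of (A): `ρ' ` with the same Frobenius polynomials a.e. as an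
  IRREDUCIBLE `ρ` has irreducible semisimplification, hence `ρ' ≅ ρ` (Chebotarev + Brauer–Nesbitt) —
  fine.  `ledger negatives --problem Langlands` (16822, 17212: `n = 0` junk; 3797): none bites (the
  summit carries `0 < n`; C has no rank binder).  Barrier catalogue
  `Literature/Barriers/Langlands/*` (9 files): every barrier applies to C as a whole (C contains each
  blocked region) and none to a lever, because C has no lever.
* §5 `-- Targets`: payload `stuck_stubs = []`, `targets = []`, no line picked (`PICKED.md` absent);
  nothing to attack.  If a lead ever registers stubs `Y₁ … Y_k` with `X ∧ ⋀ Yᵢ → Langlands`, the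
  disprover's test is §3 of `Cruxes/SectorComplement/NOTES.md` (L3): some `Yᵢ` restates the summit up
  to the sector (costume) — check `Yᵢ → C` by `exact fun h _ => …`.

No `sorry` in this file.  Nothing here asserts C, X or the summit.
-/

set_option linter.dupNamespace false

namespace Summit.Langlands.Langlands.Cruxes.SectorComplement.Disproof

open Summit.Langlands.Langlands.Theses.EisensteinGelfandKirillov

/-! ## §1 Logical position of the crux -/

/-- Readback: the crux is by definition the implication target ⇒ summit. [folklore] -/
theorem egk_sectorComplement_iff_imp :
    SectorComplement ↔ (ReducibleCrystallineModular → _root_.Langlands) :=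
  Iff.rfl

/-- The summit implies the frame (discard the sector hypothesis). [folklore] -/
theorem egk_sectorComplement_of_langlands : _root_.Langlands → SectorComplement :=
  fun h _ ↦ h

/-- Truth table: `C ↔ ¬ X ∨ Langlands`. [folklore] -/
theorem egk_sectorComplement_iff_not_or :
    SectorComplement ↔ ¬ ReducibleCrystallineModular ∨ _root_.Langlands :=
  imp_iff_not_or

/-- EXACT CONTENT OF A DISPROOF: `¬ C ↔ X ∧ ¬ Langlands` — prove the open sector theorem AND refute
the formal summit. [folklore] -/
theorem egk_not_sectorComplement_iff :
    ¬ SectorComplement ↔ ReducibleCrystallineModular ∧ ¬ _root_.Langlands :=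
  Classical.not_imp

/-- Any disproof of the frame is a disproof of the summit statement `_root_.Langlands`. [folklore] -/
theorem egk_not_langlands_of_not_sectorComplement : ¬ SectorComplement → ¬ _root_.Langlands :=
  mt egk_sectorComplement_of_langlands

/-- Under the route target the frame is literally the summit. [folklore] -/
theorem egk_sectorComplement_iff_langlands_of_target (hX : ReducibleCrystallineModular) :
    SectorComplement ↔ _root_.Langlands :=
  ⟨fun hC ↦ hC hX, fun h _ ↦ h⟩

/-! ## §2 The sector is inside the summit (exactness of the complement) -/

/-- **The EGK sector theorem is a consequence of the summit as typed**: `Langlands → X`.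
Direction (B) of `Langlands` at `n = 2`, `ℓ = p`, for the reciprocity data supplied by the summit's
own non-vacuity conjunct; the target's local hypothesis "crystalline for Fontaine's pinned datum"
gives "de Rham for `𝓡.pst`" because `ReciprocityData.pst` IS the pinned datum (projection-shaped
definition) and crystalline ⇒ de Rham (`IsCrystallineFramed.isDeRhamFramed`); the conclusion of (B)
(`Corresponds`) contains the target's a.e. Satake–Frobenius clause verbatim. [folklore] -/
theorem egk_target_of_langlands (hL : _root_.Langlands) : ReducibleCrystallineModular := by
  intro F _ _ _hF p _ _hp _hdisc O _hO hcpt ι ρ ρ₀ hirr _hodd hur _hup hloc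
  obtain ⟨⟨𝓡⟩, h⟩ := hL F
  have hB : Summit.Langlands.GaloisToAutomorphic 2 𝓡 hcpt := (h 𝓡 2 two_pos hcpt).2
  have hgeo : Summit.Langlands.IsGeometricFramed 𝓡 ρ :=
    ⟨hur, fun v hv ↦ (hloc v hv).2.1.isDeRhamFramed⟩
  obtain ⟨π, hLalg, hcorr⟩ := hB p ι ρ hirr hgeo
  exact ⟨π, hLalg, hcorr.1⟩

/-- **Exact bookkeeping identity** (unavailable for the sibling ordinary sector, available here):
`Langlands ↔ X ∧ C`. The route's target and its declared complement partition the summit with no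
typing drift. [folklore] -/
theorem egk_langlands_iff_target_and_sectorComplement :
    _root_.Langlands ↔ ReducibleCrystallineModular ∧ SectorComplement :=
  ⟨fun h ↦ ⟨egk_target_of_langlands h, fun _ ↦ h⟩, fun h ↦ h.2 h.1⟩

/-- Hence refuting the TARGET would not touch the frame's refutability: `¬ X → C` (ex falso), while
`¬ X → ¬ Langlands` as well — a counterexample to Fontaine–Mazur in the sector kills the summit and
PROVES this crux. [folklore] -/
theorem egk_sectorComplement_of_not_target (hX : ¬ ReducibleCrystallineModular) :
    SectorComplement ∧ ¬ _root_.Langlands :=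
  ⟨fun h ↦ (hX h).elim, fun hL ↦ hX (egk_target_of_langlands hL)⟩

/-! ## §3 Load-bearing analysis (the crux has exactly one hypothesis, the target `X`) -/

/-- `SectorComplement` with its only hypothesis `ReducibleCrystallineModular` DROPPED: this is the
summit statement itself. (The protocol's `egk_sectorComplement_false_without_target :
¬ SectorComplementWithoutTarget` would be `¬ Langlands`; it is not available — it would refute the
audited summit — and is deliberately NOT stated, not even with `sorry`.) [folklore] -/
def SectorComplementWithoutTarget : Prop := _root_.Langlands

/-- Dropping the hypothesis costs exactly the target: `C-without-X ↔ X ∧ C`. So the hypothesis `X`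
is load-bearing precisely to the extent that `X` is itself open. [folklore] -/
theorem egk_sectorComplementWithoutTarget_iff :
    SectorComplementWithoutTarget ↔ ReducibleCrystallineModular ∧ SectorComplement :=
  egk_langlands_iff_target_and_sectorComplement

/-- The other three hypotheses of the deciding theorem `closes` (door `EisensteinGKBound`, engine
`ProModularOfGKBound`, exit `CrystallineProModularClassical`) yield the target (this is the body of
the route's sorry-free `closes`, restated with the target as conclusion of an implication so that
nothing positive is asserted). [folklore] -/
theorem egk_target_of_cruxes (h₂ : EisensteinGKBound) (h₃ : ProModularOfGKBound)
    (h₄ : CrystallineProModularClassical) : ReducibleCrystallineModular := by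
  intro F _ _ hF p _ hp hdisc O hO hcpt ι ρ ρ₀ hirr hodd hur hup hloc
  have hpm := h₃ h₂ F hF p hp hdisc O hO ρ ρ₀ hirr hodd hur hup (fun v hv ↦ (hloc v hv).1)
  exact h₄ F hF p hp hdisc hcpt ι ρ hirr hodd hur hpm
    (fun v hv ↦ ⟨(hloc v hv).2.1, (hloc v hv).2.2⟩)

/-- … so once the route's own cruxes land, this item IS the summit: `C ↔ Langlands`. [folklore] -/
theorem egk_sectorComplement_iff_langlands_of_cruxes (h₂ : EisensteinGKBound)
    (h₃ : ProModularOfGKBound) (h₄ : CrystallineProModularClassical) :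
    SectorComplement ↔ _root_.Langlands :=
  ⟨fun hC ↦ closes h₂ h₃ h₄ hC, fun h _ ↦ h⟩

/-- What the frame smuggles, made explicit: frame + target deliver a local Langlands datum for
`GL_n(F_v)` at EVERY finite place of EVERY number field (Harris–Taylor/Henniart debt of `𝓡`), far
outside the `GL₂`/totally-real sector. [folklore] -/
theorem egk_sectorComplement_localLanglandsDebt (hC : SectorComplement)
    (hX : ReducibleCrystallineModular) (F : Type) [Field F] [NumberField F]
    (v : IsDedekindDomain.HeightOneSpectrum (NumberField.RingOfIntegers F)) :
    Nonempty (Literature.NumberTheory.Automorphic.LocalLanglandsDatum (v.adicCompletion F)) := by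
  obtain ⟨⟨𝓡⟩, -⟩ := hC hX F
  exact ⟨𝓡.llc v⟩

/-! ## §4 Natural strengthenings / junk models

None is finitely checkable: the only strengthening of `C = (X → Langlands)` inside the route's cone is
`Langlands` itself (§3), and C has no binders to specialise.  See the module docstring, §4, for the
paper probes of the summit's corners. -/

/-! ## §5 Targets (lead's stuck stubs)

`targets = []`, `stuck_stubs = []`, no `PICKED.md` for stmt-Langlands-18275 (2026-08-17). -/

end Summit.Langlands.Langlands.Cruxes.SectorComplement.Disproof


/-!
# PART II — Disproof of `SectorComplement` — findings (crux stmt-Langlands-18745)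

ITEM. `Summit.Langlands.Langlands.Theses.SectorComplement : Prop := X → _root_.Langlands`
with the target `X = OddRegularReciprocityQ` INLINED (so `C ↔ (X → Langlands)` is `Iff.rfl`,
`dor_sectorComplement_iff_imp`): the route's JUNCTION, rank 9, "the rest of the summit along this
line … never staffed from this route".  `X` = clause (B) of the summit on the sector `n = 2`, `F = ℚ`,
`ρ` odd, Hodge–Tate regular, every prime `ℓ` (odd regular Fontaine–Mazur over `ℚ`, a.e. form).

VERDICT OF THE DISPROVER (cycle 1, 2026-08-17): NO KILL, and none is available short of refuting the
audited summit statement.  Kernel-checked below (0 sorries in this part), and the negative-side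
lemmas are LANDED as `Theorems/SectorComplement/Negative/DyadicOddResidueSectorComplementPosition.lean`
(proposal p144479: `dyadicOddResidue_not_sectorComplement_iff`, `…_not_langlands_of_not_target`,
`…_not_target_iff_sectors`, `…_not_langlands_of_not_sector`, `…_sectorComplement_iff_not_or`).

* §D1 logical position — `dor_not_sectorComplement_iff : ¬ C ↔ X ∧ ¬ Langlands`: a disproof of C is
  EXACTLY a proof of the open sector theorem X (odd HT-regular Fontaine–Mazur for `GL₂/ℚ` at EVERY
  prime, including the unprinted dyadic residue `ℓ = 2` with solvable residual image — the route's own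
  live cruxes K1 `DyadicEisensteinFM`, K2 `DyadicDihedralFM`) TOGETHER WITH a refutation of the formal
  summit.  `dor_target_of_langlands : Langlands → X` — the sector is INSIDE the summit as typed
  (direction (B) at `n = 2`, `F = ℚ`, `𝓡` from the summit's conjunct `Nonempty (ReciprocityData ℚ)`;
  the target's pinned de Rham clause `(fontainePstAdicCompletion v ℓ hv).IsDeRhamFramed (ρ.toLocal v)`
  is `(𝓡.pst ℓ v hv).IsDeRhamFramed …` by `rfl`, `ReciprocityData.pst` being the projection-shaped
  definition of the pinned datum; the a.e. `SatakeFrobCompatibleAt` clause is `Corresponds.1`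
  verbatim).  Hence the exact bookkeeping identity `dor_langlands_iff_target_and_sectorComplement :
  Langlands ↔ X ∧ C` — no typing drift between the target's conclusion and (B) to exploit — and
  `dor_sectorComplement_of_not_target : ¬ X → C ∧ ¬ Langlands` (a counterexample to Fontaine–Mazur in
  the sector PROVES the junction ex falso and kills the summit; it never refutes the junction).
* §D2 the route's trichotomy — `dor_target_iff_sectors : X ↔ K1 ∧ K2 ∧ S1 ∧ S2` (`ℓ = 2`?,
  residually absolutely irreducible?, solvable residual image? — the body of `closes` one way, plain
  restriction the other): the four declared sectors PARTITION the target, each is inside the summit,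
  and under the other four hypotheses of `closes` the junction IS the summit
  (`dor_sectorComplement_iff_langlands_of_cruxes`), i.e. `Langlands ↔ K1 ∧ K2 ∧ S1 ∧ S2 ∧ C`
  (`dor_langlands_iff_items`).
* §D3 load-bearing analysis — C has ONE hypothesis, X.  Dropping it gives the summit
  (`DorSectorComplementWithoutTarget := Langlands`, `dor_sectorComplementWithoutTarget_iff :
  … ↔ X ∧ C`); the protocol's `dor_sectorComplement_false_without_target` would be `¬ Langlands` and
  is NOT available (audited summit) — deliberately not stated, not even with `sorry`.  Weakening
  hypotheses INSIDE X (X sits in negative position) only weakens C, so no `_false_without_` lemma exists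
  there either.  What the proof `Langlands → X` does NOT use is recorded as a theorem: oddness and
  Hodge–Tate regularity — `dor_targetWithoutOddRegular_of_langlands : Langlands →
  DorTargetWithoutOddRegular` (X with `IsOdd` and the `Nodup` clause deleted: Fontaine–Mazur–Langlands
  for ALL irreducible geometric `ρ : Γ_ℚ → GL₂(ℚ̄_ℓ)`, even and irregular included).  So
  `dor_sectorComplement_evenIrregularDebt : C → X → DorTargetWithoutOddRegular` makes explicit the
  first things the junction smuggles past the sector: the EVEN sector (route EvenVoidBelowEight's) and
  the EQUAL-WEIGHT sector (Artin / weight one / Maass `λ = 1/4`), besides (A), local–global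
  compatibility at every finite place, `n ≠ 2`, `F ≠ ℚ` and the local Langlands debt of `𝓡`
  (`dor_sectorComplement_localLanglandsDebt`).
* §D4 co-located frames — `dor_frames_agree : X ∧ C ↔ X_egk ∧ C_egk` (both sides `↔ Langlands`):
  this junction and PART I's frame (stmt-18275) can only close together, with the summit.  (Certified
  twin outside this file: `OddResidueBelowFive.OddSectorToLanglands`, stmt-Langlands-18720, grounder's
  TwinItems.lean.)
* §D5 attacks that are N/A or empty, recorded so nobody repeats them (same as PART I §4, re-verified
  for this item): C is a closed implication between two closed Props — NO binders — so
  degenerate-instance / junk-model / quantifier-order / finite-model (`decide`) / `kit compute`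
  attacks do not exist at C; triviality probes on C by name (`simp [SectorComplement]`, `decide`,
  `aesop`, `exact?`, `tauto`) and on `¬ C` all fail (rattack-18745, re-run here: W.lean rc 0 with the
  single `sorry`); natural strengthenings of C inside the cone = `Langlands` itself; `ledger negatives
  --problem Langlands` (n = 0 junk ×2, 3797) bite nothing (no rank binder in C; the summit carries
  `0 < n`); every `Literature/Barriers/Langlands/*` barrier applies to C as a whole (C contains each
  blocked region) and none to a lever (C has none).  Hypotheses of X read back (for the record, they
  cannot change the verdict: X vacuous ⇒ X provable ⇒ C ↔ Langlands; X false ⇒ C provable ex falso AND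
  ¬Langlands): `IsOdd` is the ∀-form over `IsComplexConjugation φ c` (at worst vacuously true, never
  unsatisfiable); the de Rham / `Nodup` clause is relative to the PINNED Fontaine datum (same term as
  the summit's `𝓡.pst`); conclusion type `CuspidalAutomorphicRepData 2 ℚ hcpt` has no junk inhabitant.
* §D6 `-- Targets`: payload `targets = []`, `stuck_stubs = []`, no line picked for stmt-18745
  (`PICKED.md` is PART I's).  PROSPECTIVE (ideas filed 2026-08-17: `reciprocity-rigidity`,
  `regular-fern-weight-one`, `parity-pins-infinity-type`): the only Lean sketch,
  `Sketch_18745_r1_k1.lean` (idea reciprocity-rigidity), reduces C to `R ∧ (X → LanglandsExists)` with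
  `LanglandsExists` the `∃ 𝓡`-form of the summit; its residual global stub `X → LanglandsExists` is
  implied by C outright (`Langlands → LanglandsExists` needs no rigidity) and is the whole pre-re-type
  summit outside the sector — un-killable in-tree for the same reason as C (`¬ (X → L∃) → ¬ L∃ →
  ¬ Langlands`); its local stub `RecRigidityGeneric` (two PINNED local Langlands data agree on generic
  classes) cannot be refuted in-tree either (a counterexample is a pair of distinct
  `LocalLanglandsDatum`s, and the tree constructs none), and is Henniart 1993 Thm 1.1 in substance IF
  the typed `IsLocalLanglandsGL` is as sharp as Henniart's characterisation — the disprover's test for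
  that stub, when it becomes a target, is whether the typed `lFactor_pairs`/`epsilon_pairs` clauses
  pin `rec_n` on generic NON-supercuspidal classes (they quantify over generic pairs only; rank-2
  closed form in NOTES-18745-r1-k1 §3(c)).  Costume test for any future line `Y₁ … Y_k` with
  `X ∧ ⋀ Yᵢ → Langlands`: some `Yᵢ → C` by `fun h _ ↦ …` (then `Yᵢ` restates the summit up to the
  sector).

No `sorry` in this part.  Nothing here asserts C, X, any sector statement or the summit.
-/

namespace Summit.Langlands.Langlands.Cruxes.SectorComplement.Disproof

section DyadicOddResidue

open Summit.Langlands.Langlands.Theses.DyadicOddResidue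

/-! ## §D1 Logical position of the junction -/

/-- Readback: the junction is by definition the implication target ⇒ summit (the target text is
inlined in the junction; the two agree syntactically). [folklore] -/
theorem dor_sectorComplement_iff_imp :
    SectorComplement ↔ (OddRegularReciprocityQ → _root_.Langlands) :=
  Iff.rfl

/-- The summit implies the junction (discard the sector hypothesis). [folklore] -/
theorem dor_sectorComplement_of_langlands : _root_.Langlands → SectorComplement :=
  fun h _ ↦ h

/-- Truth table: `C ↔ ¬ X ∨ Langlands`. [folklore] -/
theorem dor_sectorComplement_iff_not_or :
    SectorComplement ↔ ¬ OddRegularReciprocityQ ∨ _root_.Langlands :=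
  imp_iff_not_or

/-- EXACT CONTENT OF A DISPROOF: `¬ C ↔ X ∧ ¬ Langlands` — prove the open sector theorem AND refute
the formal summit. [folklore] -/
theorem dor_not_sectorComplement_iff :
    ¬ SectorComplement ↔ OddRegularReciprocityQ ∧ ¬ _root_.Langlands :=
  Classical.not_imp

/-- Any disproof of the junction is a disproof of the summit statement `_root_.Langlands`.
[folklore] -/
theorem dor_not_langlands_of_not_sectorComplement :
    ¬ SectorComplement → ¬ _root_.Langlands :=
  mt dor_sectorComplement_of_langlands

/-- Under the route target the junction is literally the summit. [folklore] -/
theorem dor_sectorComplement_iff_langlands_of_target (hX : OddRegularReciprocityQ) :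
    SectorComplement ↔ _root_.Langlands :=
  ⟨fun hC ↦ hC hX, fun h _ ↦ h⟩

/-- **The target is a consequence of the summit as typed**: `Langlands → X`.  Direction (B) of
`Langlands` at `n = 2`, `F = ℚ`, for the reciprocity data supplied by the summit's own non-vacuity
conjunct; the target's hypothesis "de Rham for Fontaine's pinned datum" IS "de Rham for `𝓡.pst`"
(`ReciprocityData.pst` is the pinned datum by definition); the conclusion of (B) (`Corresponds`)
contains the target's a.e. Satake–Frobenius clause verbatim; `IsOdd` and the regularity (`Nodup`)
clause are unused. [folklore] -/
theorem dor_target_of_langlands (hL : _root_.Langlands) : OddRegularReciprocityQ := by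
  intro ℓ _ ρ hirr _hodd hur hdR hcpt ι
  obtain ⟨⟨𝓡⟩, h⟩ := hL ℚ
  have hB : Summit.Langlands.GaloisToAutomorphic 2 𝓡 hcpt := (h 𝓡 2 two_pos hcpt).2
  have hgeo : Summit.Langlands.IsGeometricFramed 𝓡 ρ := ⟨hur, fun v hv ↦ (hdR v hv).1⟩
  obtain ⟨π, hLalg, hcorr⟩ := hB ℓ ι ρ hirr hgeo
  exact ⟨π, hLalg, hcorr.1⟩

/-- **Exact bookkeeping identity**: `Langlands ↔ X ∧ C`.  The route's target and its declared
junction partition the summit with no typing drift. [folklore] -/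
theorem dor_langlands_iff_target_and_sectorComplement :
    _root_.Langlands ↔ OddRegularReciprocityQ ∧ SectorComplement :=
  ⟨fun h ↦ ⟨dor_target_of_langlands h, fun _ ↦ h⟩, fun h ↦ h.2 h.1⟩

/-- Hence refuting the TARGET would not refute the junction: `¬ X → C` (ex falso) and
`¬ X → ¬ Langlands` — a counterexample to odd regular Fontaine–Mazur over `ℚ` kills the summit and
PROVES this crux. [folklore] -/
theorem dor_sectorComplement_of_not_target (hX : ¬ OddRegularReciprocityQ) :
    SectorComplement ∧ ¬ _root_.Langlands :=
  ⟨fun h ↦ (hX h).elim, fun hL ↦ hX (dor_target_of_langlands hL)⟩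

/-! ## §D2 The route's trichotomy partitions the target -/

/-- `X ↔ K1 ∧ K2 ∧ S1 ∧ S2`: the target is the conjunction of the four declared sector statements
(`→` restriction; `←` the case split of `closes` on `ℓ = 2`, residual absolute irreducibility,
solvability of the residual image). [folklore] -/
theorem dor_target_iff_sectors :
    OddRegularReciprocityQ ↔
      DyadicEisensteinFM ∧ DyadicDihedralFM ∧ OddPrimesRegularFM ∧ DyadicNonsolvableFM := by
  constructor
  · intro hX
    refine ⟨?_, ?_, ?_, ?_⟩
    · intro ℓ _ _ ρ _ hirr hodd hunr hdR hcpt ι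
      exact hX ℓ ρ hirr hodd hunr hdR hcpt ι
    · intro ℓ _ _ ρ _ _ hirr hodd hunr hdR hcpt ι
      exact hX ℓ ρ hirr hodd hunr hdR hcpt ι
    · intro ℓ _ _ ρ hirr hodd hunr hdR hcpt ι
      exact hX ℓ ρ hirr hodd hunr hdR hcpt ι
    · intro ℓ _ _ ρ _ _ hirr hodd hunr hdR hcpt ι
      exact hX ℓ ρ hirr hodd hunr hdR hcpt ι
  · rintro ⟨h₁, h₂, h₃, h₄⟩ ℓ _ ρ hirr hodd hunr hdR hcpt ι
    by_cases hℓ : ℓ = 2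
    · by_cases hres : ρ.IsResiduallyAbsIrreducible
      · by_cases hsol : IsSolvable ρ.residualRep.range
        · exact h₂ ℓ hℓ ρ hres hsol hirr hodd hunr hdR hcpt ι
        · exact h₄ ℓ hℓ ρ hres hsol hirr hodd hunr hdR hcpt ι
      · exact h₁ ℓ hℓ ρ hres hirr hodd hunr hdR hcpt ι
    · exact h₃ ℓ hℓ ρ hirr hodd hunr hdR hcpt ι

/-- Where a counterexample to the target can live: `¬ X ↔ ¬ K1 ∨ ¬ K2 ∨ ¬ S1 ∨ ¬ S2`. [folklore] -/
theorem dor_not_target_iff_sectors :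
    ¬ OddRegularReciprocityQ ↔
      ¬ DyadicEisensteinFM ∨ ¬ DyadicDihedralFM ∨ ¬ OddPrimesRegularFM ∨ ¬ DyadicNonsolvableFM := by
  rw [dor_target_iff_sectors]
  tauto

/-- Each sector — in particular the two live dyadic cruxes — is inside the summit as typed, so a
counterexample in any of them refutes `Langlands` (and proves the junction ex falso). [folklore] -/
theorem dor_not_langlands_of_not_sector
    (h : ¬ DyadicEisensteinFM ∨ ¬ DyadicDihedralFM ∨ ¬ OddPrimesRegularFM ∨ ¬ DyadicNonsolvableFM) :
    ¬ _root_.Langlands :=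
  fun hL ↦ dor_not_target_iff_sectors.2 h (dor_target_of_langlands hL)

/-- The other four hypotheses of the deciding theorem `closes` yield the target (its body, restated
with the target as conclusion so that nothing positive is asserted unconditionally). [folklore] -/
theorem dor_target_of_cruxes (h₁ : DyadicEisensteinFM) (h₂ : DyadicDihedralFM)
    (h₃ : OddPrimesRegularFM) (h₄ : DyadicNonsolvableFM) : OddRegularReciprocityQ :=
  dor_target_iff_sectors.2 ⟨h₁, h₂, h₃, h₄⟩

/-- … so once the route's own cruxes and supports land, this item IS the summit: `C ↔ Langlands`.
[folklore] -/
theorem dor_sectorComplement_iff_langlands_of_cruxes (h₁ : DyadicEisensteinFM)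
    (h₂ : DyadicDihedralFM) (h₃ : OddPrimesRegularFM) (h₄ : DyadicNonsolvableFM) :
    SectorComplement ↔ _root_.Langlands :=
  -- REPAIR (refuter-cdisprove-stmt-Langlands-16781-0, PART III seat, 2026-08-17): route DyadicOddResidue
  -- rev 5 re-typed `closes` (K2 split into `DihedralProModularityCore` / `ProModularClassicality` /
  -- `DyadicDihedralPrintedCellsFM` + glue), so the former proof term `closes h₁ h₂ h₃ h₄ hC` no longer
  -- elaborates; the statement is unchanged and proved through PART II's own `dor_target_of_cruxes`.
  ⟨fun hC ↦ hC (dor_target_of_cruxes h₁ h₂ h₃ h₄), fun h _ ↦ h⟩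

/-- The route's five non-assembly items are jointly EQUIVALENT to the summit:
`Langlands ↔ K1 ∧ K2 ∧ S1 ∧ S2 ∧ C`. [folklore] -/
theorem dor_langlands_iff_items :
    _root_.Langlands ↔ DyadicEisensteinFM ∧ DyadicDihedralFM ∧ OddPrimesRegularFM ∧
      DyadicNonsolvableFM ∧ SectorComplement := by
  rw [dor_langlands_iff_target_and_sectorComplement, dor_target_iff_sectors]
  simp only [and_assoc]

/-! ## §D3 Load-bearing analysis (one hypothesis, the target `X`; what `Langlands → X` ignores) -/

/-- `SectorComplement` with its only hypothesis DROPPED: the summit statement itself.  (The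
protocol's `dor_sectorComplement_false_without_target : ¬ DorSectorComplementWithoutTarget` would
be `¬ Langlands`; it is not available and deliberately NOT stated.) [folklore] -/
def DorSectorComplementWithoutTarget : Prop := _root_.Langlands

/-- Dropping the hypothesis costs exactly the target: `C-without-X ↔ X ∧ C`. [folklore] -/
theorem dor_sectorComplementWithoutTarget_iff :
    DorSectorComplementWithoutTarget ↔
      OddRegularReciprocityQ ∧ SectorComplement :=
  dor_langlands_iff_target_and_sectorComplement

/-- The target with `IsOdd` AND the Hodge–Tate-regularity (`Nodup`) clause DELETED:
Fontaine–Mazur–Langlands (a.e. form) for EVERY irreducible, a.e. unramified `ρ : Γ_ℚ → GL₂(ℚ̄_ℓ)`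
de Rham at `ℓ` for the pinned datum — even `ρ` and equal weights (Artin, weight one) included.
Used only to make explicit what the junction smuggles; never asserted. [folklore] -/
def DorTargetWithoutOddRegular : Prop :=
  ∀ (ℓ : ℕ) [Fact ℓ.Prime]
    (ρ : Literature.NumberTheory.GaloisRepresentations.FramedGaloisRep ℚ (PadicAlgCl ℓ) 2),
    ρ.toGaloisRep.IsIrreducible →
    (∀ᶠ v : IsDedekindDomain.HeightOneSpectrum (NumberField.RingOfIntegers ℚ) in Filter.cofinite,
      ρ.IsUnramifiedAt v) →
    (∀ (v : IsDedekindDomain.HeightOneSpectrum (NumberField.RingOfIntegers ℚ))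
      (hv : ((ℓ : ℕ) : NumberField.RingOfIntegers ℚ) ∈ v.asIdeal),
      (Literature.NumberTheory.PAdicHodge.fontainePstAdicCompletion v ℓ hv).IsDeRhamFramed
        (ρ.toLocal v)) →
    ∀ (hcpt : Literature.NumberTheory.Automorphic.isCompact_glFiniteIntegralLevel 2 ℚ)
      (ι : PadicAlgCl ℓ ≃+* ℂ),
      ∃ π : Literature.NumberTheory.Automorphic.CuspidalAutomorphicRepData 2 ℚ hcpt,
        π.1.IsLAlgebraic ∧
        ∀ᶠ v : IsDedekindDomain.HeightOneSpectrum (NumberField.RingOfIntegers ℚ) in Filter.cofinite,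
          Summit.Langlands.SatakeFrobCompatibleAt ι π.1 ρ v

/-- `Langlands → X⁻` where `X⁻` is the target without oddness and regularity: the same five-line
proof as `dor_target_of_langlands` — those two hypotheses are decoration as far as the summit is
concerned. [folklore] -/
theorem dor_targetWithoutOddRegular_of_langlands (hL : _root_.Langlands) :
    DorTargetWithoutOddRegular := by
  intro ℓ _ ρ hirr hur hdR hcpt ι
  obtain ⟨⟨𝓡⟩, h⟩ := hL ℚ
  have hB : Summit.Langlands.GaloisToAutomorphic 2 𝓡 hcpt := (h 𝓡 2 two_pos hcpt).2
  obtain ⟨π, hLalg, hcorr⟩ := hB ℓ ι ρ hirr ⟨hur, fun v hv ↦ hdR v hv⟩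
  exact ⟨π, hLalg, hcorr.1⟩

/-- `X⁻ → X` (restriction): the deleted hypotheses only shrink the target. [folklore] -/
theorem dor_target_of_targetWithoutOddRegular (h : DorTargetWithoutOddRegular) :
    OddRegularReciprocityQ :=
  fun ℓ _ ρ hirr _hodd hur hdR hcpt ι ↦ h ℓ ρ hirr hur (fun v hv ↦ (hdR v hv).1) hcpt ι

/-- **What the junction smuggles, made explicit (i)**: junction + target deliver Fontaine–Mazur for
EVEN and for IRREGULAR two-dimensional geometric `ρ` over `ℚ` — the sectors of routes
EvenVoidBelowEight (even, regular: void by Calegari) and of the Artin / weight-one lines — far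
outside "odd, regular". [folklore] -/
theorem dor_sectorComplement_evenIrregularDebt (hC : SectorComplement)
    (hX : OddRegularReciprocityQ) : DorTargetWithoutOddRegular :=
  dor_targetWithoutOddRegular_of_langlands (hC hX)

/-- **What the junction smuggles (ii)**: a local Langlands datum for `GL_n(F_v)` at EVERY finite
place of EVERY number field (the Harris–Taylor/Henniart debt of `𝓡`). [folklore] -/
theorem dor_sectorComplement_localLanglandsDebt (hC : SectorComplement)
    (hX : OddRegularReciprocityQ) (F : Type) [Field F] [NumberField F]
    (v : IsDedekindDomain.HeightOneSpectrum (NumberField.RingOfIntegers F)) :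
    Nonempty (Literature.NumberTheory.Automorphic.LocalLanglandsDatum (v.adicCompletion F)) := by
  obtain ⟨⟨𝓡⟩, -⟩ := hC hX F
  exact ⟨𝓡.llc v⟩

/-! ## §D4 The co-located frames agree -/

/-- PART I's frame (stmt-18275, route EisensteinGelfandKirillov) and this junction are the same item
modulo their targets: `X ∧ C ↔ X_egk ∧ C_egk`, both sides being `↔ Langlands`. [folklore] -/
theorem dor_frames_agree :
    (OddRegularReciprocityQ ∧ SectorComplement) ↔
      (Theses.EisensteinGelfandKirillov.ReducibleCrystallineModular ∧
        Theses.EisensteinGelfandKirillov.SectorComplement) :=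
  dor_langlands_iff_target_and_sectorComplement.symm.trans
    egk_langlands_iff_target_and_sectorComplement

/-! ## §D5 Natural strengthenings / junk models

None is finitely checkable: the only strengthening of `C = (X → Langlands)` inside the route's cone is
`Langlands` itself (§D3), and C has no binders to specialise.  See the PART II docblock, §D5. -/

/-! ## §D6 Targets (lead's stuck stubs)

`targets = []`, `stuck_stubs = []`, no line picked for stmt-Langlands-18745 (2026-08-17).  Prospective
stubs of idea `reciprocity-rigidity` (`Sketch_18745_r1_k1.lean`): see the PART II docblock, §D6. -/

end DyadicOddResidue

end Summit.Langlands.Langlands.Cruxes.SectorComplement.Disproof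


/-!
# PART III — Disproof of `RamifiedCoefficientSeed.SectorComplement` — findings (crux stmt-Langlands-16781)

ITEM. `Summit.Langlands.Langlands.Theses.RamifiedCoefficientSeed.SectorComplement : Prop :=
NonPolarisableFamilyAutomorphic → _root_.Langlands` (crux rank 5; route docstring: "OUT-OF-SCOPE
REMAINDER = the rest of the summit … Trivially implied by Langlands; filed only so that `closes` honestly
concludes the summit constant … never staffed from this route", difficulty open-problem).  Below
X := `NonPolarisableFamilyAutomorphic` (the route TARGET, stmt-16777: `∃ p ≥ 11, ∃ f : ℕ → (Γ_ℚ → GL₃(ℚ̄_p))`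
pairwise twist-inequivalent, member-wise NOT essentially self-dual, member-wise cuspidal automorphic —
L-algebraic `π`, Satake–Frobenius matching a.e., for every `ι` and `hcpt`), C := the item,
S := `_root_.Langlands`.  Seat refuter-cdisprove-stmt-Langlands-16781-0, cycle 1, 2026-08-17.

VERDICT OF THE DISPROVER: NO KILL — and, unlike PARTS I/II, NONE IS AVAILABLE IN THE CURRENT TREE EVEN IF
THE FORMAL SUMMIT WERE JUNK-FALSE: `¬ C ↔ X ∧ ¬ S` (§R1) and X is an EXISTENCE statement over
`CuspidalAutomorphicRepData 3 ℚ hcpt`, for which the tree has no constructor (no cusp form on `GL₃`, no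
automorphic induction, no `Ind χ` with automorphy).  Kernel-checked below (0 sorries in this part):

* §R1 logical position — `rcs_not_sectorComplement_iff : ¬ C ↔ X ∧ ¬ S`; `rcs_sectorComplement_of_langlands :
  S → C`; `rcs_not_langlands_of_not_sectorComplement : ¬ C → ¬ S`; truth table `C ↔ ¬ X ∨ S`; under X,
  `C ↔ S`.
* §R2 THE TARGET IS EXISTENTIAL — what separates X from a consequence of S is exactly a GALOIS-SIDE
  family and nothing automorphic: `RcsGeometricFamily` := `∃ p ≥ 11, ∃ f` pairwise twist-inequivalent,
  member-wise non-self-dual, IRREDUCIBLE, a.e. unramified, de Rham above `p` for Fontaine's pinned datum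
  (the summit's own (B)-hypotheses: no residual duality, no conjugation trace, no crystallinity, no
  Hodge–Tate weights, no residual irreducibility, no `p ≥ 11` used).
  `rcs_target_of_geometricFamily_of_langlands : RcsGeometricFamily → S → X` (direction (B) at `n = 3`,
  `F = ℚ`, `𝓡` from the summit's non-vacuity conjunct, `𝓡.pst = fontainePstAdicCompletion` by `rfl`,
  `Corresponds.1` is X's a.e. Satake clause verbatim); hence
  `rcs_langlands_iff_target_and_sectorComplement_of_geometricFamily : RcsGeometricFamily → (S ↔ X ∧ C)`
  and `rcs_sectorComplement_and_not_langlands_of_not_target : RcsGeometricFamily → ¬ X → C ∧ ¬ S`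
  (given the Galois-side family, a failure of automorphy in the sector is a counterexample to
  Fontaine–Mazur–Langlands: it PROVES the frame ex falso and refutes the summit; it never refutes the
  frame).  `rcs_geometricFamily_of_explicitFamily : ExplicitRamifiedFamily → RcsGeometricFamily`
  (crystalline ⇒ de Rham, `IsCrystallineFramed.isDeRhamFramed`; residually abs. irreducible over `ℚ(ζ_p)`
  ⇒ absolutely irreducible over `ℚ(ζ_p)` ⇒ over `ℚ` ⇒ irreducible —
  `IsResiduallyAbsIrreducible.isAbsolutelyIrreducible`, `IsAbsolutelyIrreducible.of_restrictField`,
  `FramedRep.isIrreducible_toContinuousRep_iff`; the residual-duality and conjugation clauses of crux r2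
  are NOT used) sharpens the strategist's `ExplicitRamifiedFamily → (S ↔ X ∧ C)`
  (`Position_RamifiedCoefficientSeed.lean`, namespace `…EquivalenceAuditRCS`, cstrat-q1) to the
  Galois-side existence alone: `rcs_not_langlands_of_explicitFamily_of_not_target :
  ExplicitRamifiedFamily → ¬ X → ¬ S`.
* §R3 load-bearing analysis — C has ONE hypothesis, X, in negative position.  Dropping it gives S
  (`RcsSectorComplementWithoutTarget := S`; `… ↔ X ∧ C` given the Galois-side family); weakening X to
  ANY `X'` gives a frame `X' → S` that is still summit-implied (`rcs_frame_of_langlands`) with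
  `¬ (X' → S) ↔ X' ∧ ¬ S` (`rcs_not_frame_iff`): no member of the whole lattice of frames is refutable
  without `¬ S`, so the protocol's `_false_without_` lemma does not exist for this item (it would be
  `¬ S`; deliberately not stated, not even with `sorry`).  Under the route's three ranked cruxes X holds
  (`rcs_target_of_cruxes`, the body of `closes`), so `C ↔ S` (`rcs_sectorComplement_iff_langlands_of_cruxes`).
  The ENGINE crux is itself inside the summit (`rcs_adjointLiftingGL3_of_langlands : S → AdjointLiftingGL3`;
  re-derivation of rattack-16779's `SofC.lean` / the strategist's SPECIAL (i)), whence
  `rcs_not_langlands_of_not_adjointLiftingGL3 : ¬ AdjointLiftingGL3 → ¬ S` — the route header's KILL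
  CRITERION "a refutation of AdjointLiftingGL3 AS TYPED would exhibit a geometric ρ contradicting
  Fontaine–Mazur" is kernel-checked: it refutes the formal summit, and in that world the frame is EXACTLY
  `¬ X` (`rcs_sectorComplement_iff_not_target_of_not_adjointLiftingGL3`).  Given the witness family and
  the lever only, the summit splits exactly as ENGINE ∧ FRAME:
  `rcs_langlands_iff_engine_and_frame : ExplicitRamifiedFamily → AdjointSeedFromDuality →
  (S ↔ AdjointLiftingGL3 ∧ C)`.
* §R4 what the frame smuggles past the sector, by projection from `C hX : S`: a local Langlands datum at
  every finite place of every number field (`rcs_sectorComplement_localLanglandsDebt`); direction (A) for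
  EVERY `n`, `F`, `𝓡` — in particular for the non-regular (Artin-type, Harish-Chandra parameter
  `(0,0,0)`) cuspidal `π` on `GL₃/ℚ` which in print WITNESS X (§R6) and for which no Galois representation
  is known (`rcs_sectorComplement_directionA`); direction (B) in every rank over every field
  (`rcs_sectorComplement_directionB`).
* §R5 junk / degenerate models.  C has NO binders (a closed implication between two closed Props):
  degenerate-instance, quantifier-order, finite-model (`decide`/`native_decide`) and `kit compute` attacks
  do not exist AT C.  Triviality probes on C, on `¬ C`, on the conclusion S alone and on `X ⊢ False` all
  FAIL (this seat's `Scratch.lean`: `simp`/`tauto`/`aesop`/`decide`/`exact?` on C and `¬ C` unfolded;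
  `simp [Langlands]`/`aesop`/`exact?` on S; `simp_all`/`aesop`/`omega` on the destructured X — farm rc 1
  with exactly the four expected "unsolved goals"; `W.lean` rc 0 with the single `sorry`).  The ONE junk
  model that bears on C sits on X's conclusion type: were the audited cuspidal interface EMPTY in rank 3
  over `ℚ` (`∀ hcpt, IsEmpty (CuspidalAutomorphicRepData 3 ℚ hcpt)` — an unsatisfiable-as-typed
  `AutomorphicRepData`, the failure mode the Statement's "conjunctive ∃, fail-safe" design turns into
  FALSITY of S), X would be FALSE (`rcs_not_target_of_isEmpty_cuspidal`; `hcpt` and `ι` are discharged by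
  `isCompact_glFiniteIntegralLevel_holds` and `PadicAlgCl.nonempty_ringEquiv_complex`, so they are no
  escape) and C PROVABLE ex falso (`rcs_sectorComplement_of_isEmpty_cuspidal`): for an ∃-automorphic
  target the fail-safe direction of the summit is the TRIVIALISING direction of the frame — the opposite of
  a refutation.  Not available (cusp forms on `GL₃/ℚ` exist in print — AGG 1984 level 53 …; no `IsEmpty`
  proof is conceivable short of an artefact in the audited `AutomorphicRepData`, Statement audit
  2026-08-14), recorded only so that nobody looks for a kill there.
* §R6 in print (not kernel-checkable here; confirms rattack-16781 / cstrat-q1 §0(iii) / NOTES-16781-r1-k1 §0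
  independently): X AS TYPED omits the member-wise clauses (C) crystalline `{0,1,2}` and (E) residual
  absolute irreducibility of crux r2, so X is a THEOREM in print by degenerate Artin witnesses — `K/ℚ`
  cubic (cyclic: Arthur–Clozel 1989, Ann. Math. Stud. 120, Ch. 3 Thm 6.2; non-normal:
  Jacquet–Piatetski-Shapiro–Shalika 1981), ray-class characters `χ_q` of `K` of order `≥ 3` whose conductor
  is a single degree-one prime over a split `q`, `ρ_q = Ind_K^ℚ χ_q` (finite image ⇒ continuous
  `p`-adically for every `p`; irreducible and pairwise twist-inequivalent by Mackey and the ramification at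
  `q`; NOT essentially self-dual since `χ_q² ≠ ψ ∘ N_{K/ℚ}` on inertia at the chosen prime),
  `π_q = AI(χ_q)` cuspidal with Harish-Chandra parameter `(0,0,0)`, hence L-algebraic (BG Def. 3.1.1; for
  `n = 3` L- = C-algebraic), Satake = Frobenius a.e.  Hence IN PRINT `C ⟺ S` on the nose; IN TREE X is
  open for lack of constructors (§R2), so C is un-refutable in tree for two independent reasons (no proof
  of X; no disproof of the audited S) and un-provable short of S (or the junk emptiness of §R5).
* §R7 inputs checked: payload `targets = []`, `stuck_stubs = []`, `line = null`; `PICKED.md` of this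
  directory is the 18275 lead's (PART I's item), not this item's; `dossier_path` / `negatives_index`
  absent on the hub (as for every prior seat); `ledger negatives --problem Langlands`: nothing on rank 3 /
  non-polarisable / frames; barrier catalogue `Literature/Barriers/Langlands/*`: every barrier applies to C
  as a whole (C contains each blocked region: TwistedEndoscopySelfDual / TaylorWilesNumericalCoincidence
  (Narrow) for non-self-dual `GL₃` OUTSIDE the family, NonRegularWeightBarrier for (A) on the Artin-type
  `π` of §R6, ShimuraVarietyRealization / ShtukaConstantField for general `F`, ResiduallyReducible /
  SolvableImage for small residual images, PatchingLocalComponent / ModPLanglandsGL2BeyondQp for `ℓ = p`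
  conditions) and none to a lever, because C has no lever.
* §R8 `-- Targets`.  Payload `targets = []`, `stuck_stubs = []`, `line = null`; but the item carries a REGISTERED
  skeleton (`Lines/birth_RamifiedCoefficientSeed.lean`, sha d02cc421, planner-rrepair e75b8072, 08:48Z) with seven
  stubs W `stub_weakExistence`, B_w⁻ `stub_weakAutomorphyOffSector`, B_w⁺ `stub_nonSelfDualRankThreeAutomorphy`,
  LGC `stub_pairCompatibility`, RD `stub_reciprocityData`, JS `stub_pairLBoundaryJS` / `stub_pairLPoleJS`, whose
  composition `SectorComplement_of` binds X as `_hX` and NEVER USES IT (the line proves the summit outright), and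
  the leads (prover-line-…-0 / -c1-0) landed the sandwich `Theorems/RamifiedCoefficientSeedSectorComplementJunctionOfR.lean`
  (C ⟸ JS ∧ JS ∧ R, R = text of stmt-17925, with `S → R`).  CERTIFICATE (kernel-checked, §R8 below): EVERY non-JS
  stub is a CONSEQUENCE OF THE SUMMIT AS TYPED — `rcs_stubWeakExistence_of_langlands` (W = (A) minus
  irreducibility/LGC/uniqueness), `rcs_stubWeakAutomorphyOffSector_of_langlands` and
  `rcs_stubNonSelfDualRankThreeAutomorphy_of_langlands` (the two halves of (B)-weak; the home-sector half is the
  ∀-FORM of the route's sector — Fontaine–Mazur–Langlands for ALL irreducible geometric non-essentially-self-dual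
  rank 3 over fields of degree 1 — far more than cruxes r2–r4 deliver, and X cannot be excised from it),
  `rcs_stubPairCompatibility_of_langlands` (LGC at every `v` for every `𝓡`: (A)'s corresponding avatar `ρ₀`, then
  `ρ ≅ ρ₀` by equal Satake parameters a.e. — `hasSatakeParamAt_unique_holds` — Chebotarev + Brauer–Nesbitt —
  `nonempty_equiv_of_hasFrobCharpolyAt_eventually chebotarev_artinRep_holds` — and `exists_eq_conj_of_equiv`, and
  `Corresponds` is invariant under change of frame, `corresponds_conj`), `rcs_stubReciprocityData_of_langlands`
  (the summit's first conjunct); hence `rcs_not_langlands_of_not_stub…` for each: NO STUB OF THE LINE IS KILLABLE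
  WITHOUT REFUTING THE FORMAL SUMMIT, and the same holds for R of the JunctionOfR sandwich (`S → R` landed there).
  The two JS stubs are the Literature named facts `JacquetShalika1981_partialPairL_{boundary,pole}_repData` = items
  stmt-13622 / stmt-19093 verbatim (Arthur–Clozel (2.2)/(2.3); vetted SURVIVES by their own refuter passes; typing
  audits belong to those items).  Costume test: no single stub implies C (each is a proper piece of S); jointly they
  give S (the skeleton's `globalLanglandsCorrespondenceGLn_of` + RD), i.e. the line is "prove reciprocity for GL_n",
  X idle — consistent with §R2/§R6.  For any future line `Y₁ … Y_k` with `X ∧ ⋀ Yᵢ → S`: some `Yᵢ → C` by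
  `fun h _ ↦ …` means `Yᵢ` restates the summit up to the sector; and by §R2 any `Yᵢ` of the form "automorphy of
  the members of SOME irreducible geometric family" is summit-implied, i.e. idle toward S.

No `sorry` in this part.  Nothing here asserts C, X, any crux or the summit unconditionally.
-/

namespace Summit.Langlands.Langlands.Cruxes.SectorComplement.Disproof

section RamifiedCoefficientSeed

open Summit.Langlands.Langlands.Theses.RamifiedCoefficientSeed
open Literature.NumberTheory.GaloisRepresentations Literature.NumberTheory.Automorphic

/-! ## §R1 Logical position of the frame -/

/-- Readback: the frame is by definition the implication target ⇒ summit. [folklore] -/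
theorem rcs_sectorComplement_iff_imp :
    SectorComplement ↔ (NonPolarisableFamilyAutomorphic → _root_.Langlands) :=
  Iff.rfl

/-- The summit implies the frame (discard the sector hypothesis). [folklore] -/
theorem rcs_sectorComplement_of_langlands : _root_.Langlands → SectorComplement :=
  fun h _ ↦ h

/-- Truth table: `C ↔ ¬ X ∨ S`. [folklore] -/
theorem rcs_sectorComplement_iff_not_or :
    SectorComplement ↔ ¬ NonPolarisableFamilyAutomorphic ∨ _root_.Langlands :=
  imp_iff_not_or

/-- EXACT CONTENT OF A DISPROOF: `¬ C ↔ X ∧ ¬ S` — construct the automorphic family AND refute the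
formal summit. [folklore] -/
theorem rcs_not_sectorComplement_iff :
    ¬ SectorComplement ↔ NonPolarisableFamilyAutomorphic ∧ ¬ _root_.Langlands :=
  Classical.not_imp

/-- Any disproof of the frame is a disproof of the summit statement `_root_.Langlands`. [folklore] -/
theorem rcs_not_langlands_of_not_sectorComplement : ¬ SectorComplement → ¬ _root_.Langlands :=
  mt rcs_sectorComplement_of_langlands

/-- Under the route target the frame is literally the summit. [folklore] -/
theorem rcs_sectorComplement_iff_langlands_of_target (hX : NonPolarisableFamilyAutomorphic) :
    SectorComplement ↔ _root_.Langlands :=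
  ⟨fun hC ↦ hC hX, fun h _ ↦ h⟩

/-! ## §R2 The target is existential: a Galois-side family is exactly what the summit does not supply -/

/-- Direction (B) of the summit at `n = 3`, `F = ℚ`, weak (a.e.-Satake) form, for an IRREDUCIBLE `ρ`
unramified a.e. and de Rham above `p` for Fontaine's pinned datum (`𝓡.pst p v hv` is by definition
`fontainePstAdicCompletion v p hv`; `𝓡` from the summit's `Nonempty` conjunct). [folklore] -/
theorem rcs_weakB_rank3_of_langlands (hL : _root_.Langlands) (p : ℕ) [Fact p.Prime]
    (ρ : FramedGaloisRep ℚ (PadicAlgCl p) 3) (hirr : ρ.toGaloisRep.IsIrreducible)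
    (hunr : ∀ᶠ v : IsDedekindDomain.HeightOneSpectrum (NumberField.RingOfIntegers ℚ) in Filter.cofinite,
      ρ.IsUnramifiedAt v)
    (hdR : ∀ (v : IsDedekindDomain.HeightOneSpectrum (NumberField.RingOfIntegers ℚ))
      (hv : ((p : ℕ) : NumberField.RingOfIntegers ℚ) ∈ v.asIdeal),
      (Literature.NumberTheory.PAdicHodge.fontainePstAdicCompletion v p hv).IsDeRhamFramed (ρ.toLocal v))
    (ι : PadicAlgCl p ≃+* ℂ) (hcpt : isCompact_glFiniteIntegralLevel 3 ℚ) :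
    ∃ π : CuspidalAutomorphicRepData 3 ℚ hcpt, π.1.IsLAlgebraic ∧
      ∀ᶠ v : IsDedekindDomain.HeightOneSpectrum (NumberField.RingOfIntegers ℚ) in Filter.cofinite,
        Summit.Langlands.SatakeFrobCompatibleAt ι π.1 ρ v := by
  obtain ⟨⟨𝓡⟩, hGL⟩ := hL ℚ
  obtain ⟨π, hLalg, hcorr⟩ := (hGL 𝓡 3 (by norm_num) hcpt).2 p ι ρ hirr ⟨hunr, fun v hv ↦ hdR v hv⟩
  exact ⟨π, hLalg, hcorr.1⟩

/-- Residual absolute irreducibility over `ℚ(ζ_p)` (crux r2's clause (E)) implies irreducibility over `ℚ`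
(the summit's (B)-hypothesis): accepted `IsResiduallyAbsIrreducible.isAbsolutelyIrreducible`,
`IsAbsolutelyIrreducible.of_restrictField`, `FramedRep.isIrreducible_toContinuousRep_iff`. [folklore] -/
theorem rcs_isIrreducible_of_isResiduallyAbsIrreducible {p : ℕ} [Fact p.Prime]
    (ρ : FramedGaloisRep ℚ (PadicAlgCl p) 3)
    (hirr : (ρ.restrictField (CyclotomicField p ℚ)).IsResiduallyAbsIrreducible) :
    ρ.toGaloisRep.IsIrreducible :=
  (FramedRep.isIrreducible_toContinuousRep_iff ρ).2
    (FramedGaloisRep.IsAbsolutelyIrreducible.of_restrictField (CyclotomicField p ℚ) ρ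
      (FramedGaloisRep.IsResiduallyAbsIrreducible.isAbsolutelyIrreducible three_pos hirr)).isIrreducible

/-- **The Galois-side existence content of the target**: an infinite, pairwise twist-inequivalent family
of NON-essentially-self-dual rank-3 `p`-adic representations of `Γ_ℚ` (`p ≥ 11`), each IRREDUCIBLE,
unramified a.e. and de Rham above `p` for Fontaine's pinned datum — exactly the hypotheses of direction
(B) of the summit, member-wise; nothing automorphic, nothing residual, no weights. Used only as a
hypothesis; never asserted. [folklore] -/
def RcsGeometricFamily : Prop :=
  ∃ (p : ℕ) (_ : Fact p.Prime), 11 ≤ p ∧ ∃ f : ℕ → FramedGaloisRep ℚ (PadicAlgCl p) 3,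
    (∀ m n, m ≠ n → ¬ ∃ χ : FramedGaloisRep ℚ (PadicAlgCl p) 1, ∀ σ,
        (f m σ).val.trace = (χ σ).val 0 0 * (f n σ).val.trace) ∧
    ∀ n, (¬ ∃ χ : FramedGaloisRep ℚ (PadicAlgCl p) 1, ∀ σ,
        (f n σ⁻¹).val.trace = (χ σ).val 0 0 * (f n σ).val.trace) ∧
      (f n).toGaloisRep.IsIrreducible ∧
      (∀ᶠ v : IsDedekindDomain.HeightOneSpectrum (NumberField.RingOfIntegers ℚ) in Filter.cofinite,
        (f n).IsUnramifiedAt v) ∧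
      ∀ (v : IsDedekindDomain.HeightOneSpectrum (NumberField.RingOfIntegers ℚ))
        (hv : ((p : ℕ) : NumberField.RingOfIntegers ℚ) ∈ v.asIdeal),
        (Literature.NumberTheory.PAdicHodge.fontainePstAdicCompletion v p hv).IsDeRhamFramed
          ((f n).toLocal v)

/-- The explicit-family crux r2 supplies the Galois-side family (crystalline ⇒ de Rham; residual
absolute irreducibility over `ℚ(ζ_p)` ⇒ irreducibility; its residual-duality clause (D) and
conjugation-trace clause (F) — the inputs of the LEVER — are not used). [folklore] -/
theorem rcs_geometricFamily_of_explicitFamily (h1 : ExplicitRamifiedFamily) : RcsGeometricFamily := by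
  obtain ⟨p, hp, h11, f, hne, hf⟩ := h1
  refine ⟨p, hp, h11, f, hne, fun n ↦ ?_⟩
  obtain ⟨hnsd, hunr, hcrys, _hdual, hirr, _hcc⟩ := hf n
  exact ⟨hnsd, rcs_isIrreducible_of_isResiduallyAbsIrreducible (f n) hirr, hunr,
    fun v hv ↦ (hcrys v hv).1.isDeRhamFramed⟩

/-- **`RcsGeometricFamily → S → X`**: modulo the summit, the target is exactly the Galois-side existence
statement (direction (B) at `n = 3`, `F = ℚ`, applied member-wise at `ℓ = p`). `S → X` alone is not
formal: the summit carries no existence content. [folklore] -/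
theorem rcs_target_of_geometricFamily_of_langlands (hF : RcsGeometricFamily) (hL : _root_.Langlands) :
    NonPolarisableFamilyAutomorphic := by
  obtain ⟨p, hp, h11, f, hne, hf⟩ := hF
  refine ⟨p, hp, h11, f, hne, fun n ↦ (hf n).1, fun n ι hcpt ↦ ?_⟩
  obtain ⟨_hnsd, hirr, hunr, hdR⟩ := hf n
  exact rcs_weakB_rank3_of_langlands hL p (f n) hirr hunr hdR ι hcpt

/-- **Exact bookkeeping identity, conditional on the Galois-side family only**:
`RcsGeometricFamily → (S ↔ X ∧ C)`. [folklore] -/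
theorem rcs_langlands_iff_target_and_sectorComplement_of_geometricFamily (hF : RcsGeometricFamily) :
    _root_.Langlands ↔ NonPolarisableFamilyAutomorphic ∧ SectorComplement :=
  ⟨fun hL ↦ ⟨rcs_target_of_geometricFamily_of_langlands hF hL, fun _ ↦ hL⟩, fun h ↦ h.2 h.1⟩

/-- Given the Galois-side family, a failure of the target (non-automorphy of some member for some `ι`,
`hcpt`) is a counterexample to Fontaine–Mazur–Langlands: it PROVES the frame (ex falso) and REFUTES the
summit — it never refutes the frame. [folklore] -/
theorem rcs_sectorComplement_and_not_langlands_of_not_target (hF : RcsGeometricFamily)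
    (hX : ¬ NonPolarisableFamilyAutomorphic) : SectorComplement ∧ ¬ _root_.Langlands :=
  ⟨fun h ↦ (hX h).elim, fun hL ↦ hX (rcs_target_of_geometricFamily_of_langlands hF hL)⟩

/-- In particular with the route's own witness crux r2: `ExplicitRamifiedFamily → ¬ X → ¬ S`. [folklore] -/
theorem rcs_not_langlands_of_explicitFamily_of_not_target (h1 : ExplicitRamifiedFamily)
    (hX : ¬ NonPolarisableFamilyAutomorphic) : ¬ _root_.Langlands :=
  (rcs_sectorComplement_and_not_langlands_of_not_target (rcs_geometricFamily_of_explicitFamily h1) hX).2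

/-! ## §R3 Load-bearing analysis (one hypothesis, X, in negative position) -/

/-- `SectorComplement` with its only hypothesis DROPPED: the summit statement itself. (The protocol's
`rcs_sectorComplement_false_without_target : ¬ RcsSectorComplementWithoutTarget` would be `¬ Langlands`;
it is not available — it would refute the audited summit — and is deliberately NOT stated.) [folklore] -/
def RcsSectorComplementWithoutTarget : Prop := _root_.Langlands

/-- Dropping the hypothesis costs exactly the target, given the Galois-side family:
`C-without-X ↔ X ∧ C`. [folklore] -/
theorem rcs_sectorComplementWithoutTarget_iff_of_geometricFamily (hF : RcsGeometricFamily) :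
    RcsSectorComplementWithoutTarget ↔ NonPolarisableFamilyAutomorphic ∧ SectorComplement :=
  rcs_langlands_iff_target_and_sectorComplement_of_geometricFamily hF

/-- WEAKENING the hypothesis to any `X'` whatsoever: every frame `X' → S` is summit-implied … [folklore] -/
theorem rcs_frame_of_langlands (X' : Prop) : _root_.Langlands → (X' → _root_.Langlands) :=
  fun h _ ↦ h

/-- … and refutable exactly in the world `X' ∧ ¬ S`: no frame in the lattice is refutable without a
disproof of the formal summit (the extreme case `X' = True` is S itself). [folklore] -/
theorem rcs_not_frame_iff (X' : Prop) : ¬ (X' → _root_.Langlands) ↔ X' ∧ ¬ _root_.Langlands :=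
  Classical.not_imp

/-- The three ranked cruxes yield the target — the inner logic of `closes`, every hypothesis used: the
explicit family supplies `p ≥ 11` and `f`; member-wise, residual duality + residual irreducibility +
trace-`±1` conjugation give the odd adjoint seed (`AdjointSeedFromDuality`, `5 ≤ 11 ≤ p`), and the engine
`AdjointLiftingGL3` returns the cuspidal `π` with Satake matching a.e. [folklore] -/
theorem rcs_target_of_cruxes (h1 : ExplicitRamifiedFamily) (h2 : AdjointSeedFromDuality)
    (h3 : AdjointLiftingGL3) : NonPolarisableFamilyAutomorphic := by
  obtain ⟨p, hp, h11, f, hne, hf⟩ := h1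
  refine ⟨p, hp, h11, f, hne, fun n ↦ (hf n).1, fun n ι hcpt ↦ ?_⟩
  obtain ⟨_hnsd, hunr, hcrys, hdual, hirr, hcc⟩ := hf n
  exact h3 p h11 (f n) hunr hcrys hirr (h2 p (le_trans (by norm_num) h11) (f n) hdual hirr hcc) ι hcpt

/-- … so once the route's own cruxes land, this item IS the summit: `C ↔ S` (`→` is the route's
sorry-free deciding theorem `closes`). [folklore] -/
theorem rcs_sectorComplement_iff_langlands_of_cruxes (h1 : ExplicitRamifiedFamily)
    (h2 : AdjointSeedFromDuality) (h3 : AdjointLiftingGL3) : SectorComplement ↔ _root_.Langlands :=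
  ⟨fun hC ↦ closes h1 h2 h3 hC, fun h _ ↦ h⟩

/-- The ENGINE crux is inside the summit as typed: `S → AdjointLiftingGL3` (crystalline ⇒ de Rham; the
odd adjoint seed, the labelled weights `{0,1,2}` and `11 ≤ p` are not used). Re-derivation of
rattack-16779's `SofC.lean` and of the strategist's SPECIAL (i). [folklore] -/
theorem rcs_adjointLiftingGL3_of_langlands (hL : _root_.Langlands) : AdjointLiftingGL3 := by
  intro p _ _h11 ρ hunr hcrys hirr _hseed ι hcpt
  exact rcs_weakB_rank3_of_langlands hL p ρ (rcs_isIrreducible_of_isResiduallyAbsIrreducible ρ hirr) hunr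
    (fun v hv ↦ (hcrys v hv).1.isDeRhamFramed) ι hcpt

/-- KILL CRITERION of the route header, kernel-checked: a refutation of the engine AS TYPED refutes the
formal summit (`¬ AdjointLiftingGL3 → ¬ S`). [folklore] -/
theorem rcs_not_langlands_of_not_adjointLiftingGL3 (h : ¬ AdjointLiftingGL3) : ¬ _root_.Langlands :=
  mt rcs_adjointLiftingGL3_of_langlands h

/-- … and in that world the frame is EXACTLY the negation of the target: `¬ AdjointLiftingGL3 →
(C ↔ ¬ X)`. [folklore] -/
theorem rcs_sectorComplement_iff_not_target_of_not_adjointLiftingGL3 (h : ¬ AdjointLiftingGL3) :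
    SectorComplement ↔ ¬ NonPolarisableFamilyAutomorphic :=
  ⟨fun hC hX ↦ rcs_not_langlands_of_not_adjointLiftingGL3 h (hC hX), fun hX h' ↦ (hX h').elim⟩

/-- Given the witness family (r2) and the lever (r4) only, the summit splits EXACTLY as engine ∧ frame:
`S ↔ AdjointLiftingGL3 ∧ C`. [folklore] -/
theorem rcs_langlands_iff_engine_and_frame (h1 : ExplicitRamifiedFamily) (h2 : AdjointSeedFromDuality) :
    _root_.Langlands ↔ AdjointLiftingGL3 ∧ SectorComplement :=
  ⟨fun hL ↦ ⟨rcs_adjointLiftingGL3_of_langlands hL, fun _ ↦ hL⟩,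
    fun h ↦ h.2 (rcs_target_of_cruxes h1 h2 h.1)⟩

/-! ## §R4 What the frame smuggles past the sector (projections from `C hX : S`) -/

/-- Frame + target deliver a local Langlands datum for `GL_n(F_v)` at EVERY finite place of EVERY number
field (the Harris–Taylor/Henniart debt of `𝓡`), far outside "rank 3 over `ℚ`". [folklore] -/
theorem rcs_sectorComplement_localLanglandsDebt (hC : SectorComplement)
    (hX : NonPolarisableFamilyAutomorphic) (F : Type) [Field F] [NumberField F]
    (v : IsDedekindDomain.HeightOneSpectrum (NumberField.RingOfIntegers F)) :
    Nonempty (LocalLanglandsDatum (v.adicCompletion F)) := by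
  obtain ⟨⟨𝓡⟩, -⟩ := hC hX F
  exact ⟨𝓡.llc v⟩

/-- Frame + target deliver direction (A) for every `n`, `F`, `𝓡` — including, at `n = 3`, `F = ℚ`, the
non-regular Artin-type cuspidal `π` that witness X in print (§R6). [folklore] -/
theorem rcs_sectorComplement_directionA (hC : SectorComplement) (hX : NonPolarisableFamilyAutomorphic)
    (F : Type) [Field F] [NumberField F] (𝓡 : Summit.Langlands.ReciprocityData F) (n : ℕ) (hn : 0 < n)
    (hcpt : isCompact_glFiniteIntegralLevel n F) : Summit.Langlands.AutomorphicToGalois n 𝓡 hcpt :=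
  ((hC hX F).2 𝓡 n hn hcpt).1

/-- … and direction (B) (with local–global compatibility at every finite place, inside `Corresponds`)
for every `n`, `F`, `𝓡`. [folklore] -/
theorem rcs_sectorComplement_directionB (hC : SectorComplement) (hX : NonPolarisableFamilyAutomorphic)
    (F : Type) [Field F] [NumberField F] (𝓡 : Summit.Langlands.ReciprocityData F) (n : ℕ) (hn : 0 < n)
    (hcpt : isCompact_glFiniteIntegralLevel n F) : Summit.Langlands.GaloisToAutomorphic n 𝓡 hcpt :=
  ((hC hX F).2 𝓡 n hn hcpt).2

/-! ## §R5 The one junk model that bears on the frame: an EMPTY cuspidal interface -/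

/-- If the audited cuspidal interface were EMPTY in rank 3 over `ℚ` (an unsatisfiable-as-typed
`AutomorphicRepData` — the failure mode the Statement's fail-safe design turns into falsity of S), the
target would be FALSE: `hcpt` holds (`isCompact_glFiniteIntegralLevel_holds`) and `ι` exists
(`PadicAlgCl.nonempty_ringEquiv_complex`), so the member `f 0` would need a `π` that does not exist.
Hypothetical; recorded to close the door, not believed. [folklore] -/
theorem rcs_not_target_of_isEmpty_cuspidal
    (h : ∀ hcpt : isCompact_glFiniteIntegralLevel 3 ℚ, IsEmpty (CuspidalAutomorphicRepData 3 ℚ hcpt)) :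
    ¬ NonPolarisableFamilyAutomorphic := by
  rintro ⟨p, hp, _h11, f, _hne, _hnsd, haut⟩
  obtain ⟨ι⟩ := PadicAlgCl.nonempty_ringEquiv_complex p
  obtain ⟨π, -⟩ := haut 0 ι (isCompact_glFiniteIntegralLevel_holds 3 ℚ)
  exact (h _).false π

/-- … and the frame would be PROVABLE ex falso: for an ∃-automorphic target the fail-safe direction of
the summit is the trivialising direction of the frame — the opposite of a refutation. [folklore] -/
theorem rcs_sectorComplement_of_isEmpty_cuspidal
    (h : ∀ hcpt : isCompact_glFiniteIntegralLevel 3 ℚ, IsEmpty (CuspidalAutomorphicRepData 3 ℚ hcpt)) :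
    SectorComplement :=
  fun hX ↦ (rcs_not_target_of_isEmpty_cuspidal h hX).elim

/-! ## §R6–§R7 In print / inputs

See the PART III docblock: X as typed is a theorem in print (Artin monomial witnesses), so `C ⟺ S` in
print; inputs checked are listed there. -/

/-! ## §R8 Targets: every stub of the registered skeleton d02cc421 is summit-implied

Texts below are VERBATIM the stub statements of `Lines/birth_RamifiedCoefficientSeed.lean` (sha d02cc421);
each is derived from `_root_.Langlands`, so its negation refutes the formal summit: nothing on the line is
killable by a disprover short of `¬ S`. -/

/-- **stub W (`stub_weakExistence`) is summit-implied**: (A) of the summit minus irreducibility, local–global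
compatibility and uniqueness (`IsGeometricFramed 𝓡 ρ` is the pinned geometric clause since `𝓡.pst` is the
pinned datum by definition; `Corresponds.1` is the a.e. Satake clause). [folklore] -/
theorem rcs_stubWeakExistence_of_langlands (hL : _root_.Langlands) : ∀ (K : Type) [Field K] [NumberField K] (n : ℕ) (hcpt : Literature.NumberTheory.Automorphic.isCompact_glFiniteIntegralLevel n K), 0 < n → ∀ π : Literature.NumberTheory.Automorphic.CuspidalAutomorphicRepData n K hcpt, π.1.IsLAlgebraic → ∀ (ℓ : ℕ) [Fact ℓ.Prime] (ι : PadicAlgCl ℓ ≃+* ℂ), ∃ ρ : Literature.NumberTheory.GaloisRepresentations.FramedGaloisRep K (PadicAlgCl ℓ) n, ((∀ᶠ v : IsDedekindDomain.HeightOneSpectrum (NumberField.RingOfIntegers K) in Filter.cofinite, ρ.IsUnramifiedAt v) ∧ ∀ (v : IsDedekindDomain.HeightOneSpectrum (NumberField.RingOfIntegers K)) (hv : ((ℓ : ℕ) : NumberField.RingOfIntegers K) ∈ v.asIdeal), (Literature.NumberTheory.PAdicHodge.fontainePstAdicCompletion v ℓ hv).IsDeRhamFramed (ρ.toLocal v))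 ∧ ∀ᶠ v : IsDedekindDomain.HeightOneSpectrum (NumberField.RingOfIntegers K) in Filter.cofinite, Summit.Langlands.SatakeFrobCompatibleAt ι π.1 ρ v := by
  intro K _ _ n hcpt hn π hLalg ℓ _ ι
  obtain ⟨⟨𝓡⟩, h⟩ := hL K
  obtain ⟨ρ, -, hgeo, hcorr, -⟩ := (h 𝓡 n hn hcpt).1 π hLalg ℓ ι
  exact ⟨ρ, ⟨hgeo.1, fun v hv ↦ hgeo.2 v hv⟩, hcorr.1⟩

/-- … so a counterexample to stub W refutes the formal summit. [folklore] -/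
theorem rcs_not_langlands_of_not_stubWeakExistence (h : ¬ ∀ (K : Type) [Field K] [NumberField K] (n : ℕ) (hcpt : Literature.NumberTheory.Automorphic.isCompact_glFiniteIntegralLevel n K), 0 < n → ∀ π : Literature.NumberTheory.Automorphic.CuspidalAutomorphicRepData n K hcpt, π.1.IsLAlgebraic → ∀ (ℓ : ℕ) [Fact ℓ.Prime] (ι : PadicAlgCl ℓ ≃+* ℂ), ∃ ρ : Literature.NumberTheory.GaloisRepresentations.FramedGaloisRep K (PadicAlgCl ℓ) n, ((∀ᶠ v : IsDedekindDomain.HeightOneSpectrum (NumberField.RingOfIntegers K) in Filter.cofinite, ρ.IsUnramifiedAt v) ∧ ∀ (v : IsDedekindDomain.HeightOneSpectrum (NumberField.RingOfIntegers K)) (hv : ((ℓ : ℕ) : NumberField.RingOfIntegers K) ∈ v.asIdeal), (Literature.NumberTheory.PAdicHodge.fontainePstAdicCompletion v ℓ hv).IsDeRhamFramed (ρ.toLocal v)) ∧ ∀ᶠ v : IsDedekindDomain.HeightOneSpectrum (NumberField.RingOfIntegers K) in Filter.cofinite, Summit.Langlands.SatakeFrobCompatibleAt ι π.1 ρ v)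 : ¬ _root_.Langlands :=
  fun hL ↦ h (rcs_stubWeakExistence_of_langlands hL)

/-- **stub B_w⁻ (`stub_weakAutomorphyOffSector`) is summit-implied**: direction (B), weak form, off the home
sector (the sector exclusion is simply unused). [folklore] -/
theorem rcs_stubWeakAutomorphyOffSector_of_langlands (hL : _root_.Langlands) : ∀ (K : Type) [Field K] [NumberField K] (n : ℕ) (hcpt : Literature.NumberTheory.Automorphic.isCompact_glFiniteIntegralLevel n K), 0 < n → ∀ (ℓ : ℕ) [Fact ℓ.Prime] (ι : PadicAlgCl ℓ ≃+* ℂ) (ρ : Literature.NumberTheory.GaloisRepresentations.FramedGaloisRep K (PadicAlgCl ℓ) n), ρ.toGaloisRep.IsIrreducible → ((∀ᶠ v : IsDedekindDomain.HeightOneSpectrum (NumberField.RingOfIntegers K) in Filter.cofinite, ρ.IsUnramifiedAt v) ∧ ∀ (v : IsDedekindDomain.HeightOneSpectrum (NumberField.RingOfIntegers K)) (hv : ((ℓ : ℕ) : NumberField.RingOfIntegers K) ∈ v.asIdeal), (Literature.NumberTheory.PAdicHodge.fontainePstAdicCompletion v ℓ hv).IsDeRhamFramed (ρ.toLocal v))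 → ¬ (Module.finrank ℚ K = 1 ∧ n = 3 ∧ ¬ ∃ χ : Literature.NumberTheory.GaloisRepresentations.FramedGaloisRep K (PadicAlgCl ℓ) 1, ∀ σ, (ρ σ⁻¹).val.trace = (χ σ).val 0 0 * (ρ σ).val.trace) → ∃ π : Literature.NumberTheory.Automorphic.CuspidalAutomorphicRepData n K hcpt, π.1.IsLAlgebraic ∧ ∀ᶠ v : IsDedekindDomain.HeightOneSpectrum (NumberField.RingOfIntegers K) in Filter.cofinite, Summit.Langlands.SatakeFrobCompatibleAt ι π.1 ρ v := by
  intro K _ _ n hcpt hn ℓ _ ι ρ hirr hgeo _hoff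
  obtain ⟨⟨𝓡⟩, h⟩ := hL K
  obtain ⟨π, hLalg, hcorr⟩ := (h 𝓡 n hn hcpt).2 ℓ ι ρ hirr ⟨hgeo.1, fun v hv ↦ hgeo.2 v hv⟩
  exact ⟨π, hLalg, hcorr.1⟩

/-- … so a counterexample to stub B_w⁻ (e.g. an even irreducible geometric `ρ : Γ_ℚ → GL₂` with no cuspidal
`π`) refutes the formal summit. [folklore] -/
theorem rcs_not_langlands_of_not_stubWeakAutomorphyOffSector (h : ¬ ∀ (K : Type) [Field K] [NumberField K] (n : ℕ) (hcpt : Literature.NumberTheory.Automorphic.isCompact_glFiniteIntegralLevel n K), 0 < n → ∀ (ℓ : ℕ) [Fact ℓ.Prime] (ι : PadicAlgCl ℓ ≃+* ℂ) (ρ : Literature.NumberTheory.GaloisRepresentations.FramedGaloisRep K (PadicAlgCl ℓ) n), ρ.toGaloisRep.IsIrreducible → ((∀ᶠ v : IsDedekindDomain.HeightOneSpectrum (NumberField.RingOfIntegers K) in Filter.cofinite, ρ.IsUnramifiedAt v) ∧ ∀ (v : IsDedekindDomain.HeightOneSpectrum (NumberField.RingOfIntegers K)) (hv : ((ℓ :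 ℕ) : NumberField.RingOfIntegers K) ∈ v.asIdeal), (Literature.NumberTheory.PAdicHodge.fontainePstAdicCompletion v ℓ hv).IsDeRhamFramed (ρ.toLocal v)) → ¬ (Module.finrank ℚ K = 1 ∧ n = 3 ∧ ¬ ∃ χ : Literature.NumberTheory.GaloisRepresentations.FramedGaloisRep K (PadicAlgCl ℓ) 1, ∀ σ, (ρ σ⁻¹).val.trace = (χ σ).val 0 0 * (ρ σ).val.trace) → ∃ π : Literature.NumberTheory.Automorphic.CuspidalAutomorphicRepData n K hcpt, π.1.IsLAlgebraic ∧ ∀ᶠ v : IsDedekindDomain.HeightOneSpectrum (NumberField.RingOfIntegers K) in Filter.cofinite, Summit.Langlands.SatakeFrobCompatibleAt ι π.1 ρ v) : ¬ _root_.Langlands :=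
  fun hL ↦ h (rcs_stubWeakAutomorphyOffSector_of_langlands hL)

/-- **stub B_w⁺ (`stub_nonSelfDualRankThreeAutomorphy`, the HOME SECTOR in ∀-form) is summit-implied**:
direction (B) at `n = 3`; the degree-one and non-self-duality hypotheses are unused.  NB this stub is
Fontaine–Mazur–Langlands for EVERY irreducible geometric non-essentially-self-dual rank-3 `ρ` over a field of
degree 1 — the route's cruxes r2–r4 deliver only the explicit family inside it. [folklore] -/
theorem rcs_stubNonSelfDualRankThreeAutomorphy_of_langlands (hL : _root_.Langlands) : ∀ (K : Type) [Field K] [NumberField K], Module.finrank ℚ K = 1 → ∀ (hcpt : Literature.NumberTheory.Automorphic.isCompact_glFiniteIntegralLevel 3 K) (ℓ : ℕ) [Fact ℓ.Prime] (ι : PadicAlgCl ℓ ≃+* ℂ) (ρ : Literature.NumberTheory.GaloisRepresentations.FramedGaloisRep K (PadicAlgCl ℓ) 3), ρ.toGaloisRep.IsIrreducible → ((∀ᶠ v : IsDedekindDomain.HeightOneSpectrum (NumberField.RingOfIntegers K) in Filter.cofinite, ρ.IsUnramifiedAt v) ∧ ∀ (v : IsDedekindDomain.HeightOneSpectrum (NumberField.RingOfIntegers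 K)) (hv : ((ℓ : ℕ) : NumberField.RingOfIntegers K) ∈ v.asIdeal), (Literature.NumberTheory.PAdicHodge.fontainePstAdicCompletion v ℓ hv).IsDeRhamFramed (ρ.toLocal v)) → (¬ ∃ χ : Literature.NumberTheory.GaloisRepresentations.FramedGaloisRep K (PadicAlgCl ℓ) 1, ∀ σ, (ρ σ⁻¹).val.trace = (χ σ).val 0 0 * (ρ σ).val.trace) → ∃ π : Literature.NumberTheory.Automorphic.CuspidalAutomorphicRepData 3 K hcpt, π.1.IsLAlgebraic ∧ ∀ᶠ v : IsDedekindDomain.HeightOneSpectrum (NumberField.RingOfIntegers K) in Filter.cofinite, Summit.Langlands.SatakeFrobCompatibleAt ι π.1 ρ v := by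
  intro K _ _ _hK hcpt ℓ _ ι ρ hirr hgeo _hnsd
  obtain ⟨⟨𝓡⟩, h⟩ := hL K
  obtain ⟨π, hLalg, hcorr⟩ := (h 𝓡 3 (by norm_num) hcpt).2 ℓ ι ρ hirr ⟨hgeo.1, fun v hv ↦ hgeo.2 v hv⟩
  exact ⟨π, hLalg, hcorr.1⟩

/-- … so a counterexample to the home-sector stub (an irreducible geometric non-self-dual rank-3 `ρ` over `ℚ`
with no cuspidal `π`) refutes the formal summit. [folklore] -/
theorem rcs_not_langlands_of_not_stubNonSelfDualRankThreeAutomorphy (h : ¬ ∀ (K : Type) [Field K] [NumberField K], Module.finrank ℚ K = 1 → ∀ (hcpt : Literature.NumberTheory.Automorphic.isCompact_glFiniteIntegralLevel 3 K) (ℓ : ℕ) [Fact ℓ.Prime] (ι : PadicAlgCl ℓ ≃+* ℂ) (ρ : Literature.NumberTheory.GaloisRepresentations.FramedGaloisRep K (PadicAlgCl ℓ) 3), ρ.toGaloisRep.IsIrreducible → ((∀ᶠ v : IsDedekindDomain.HeightOneSpectrum (NumberField.RingOfIntegers K) in Filter.cofinite, ρ.IsUnramifiedAt v) ∧ ∀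 (v : IsDedekindDomain.HeightOneSpectrum (NumberField.RingOfIntegers K)) (hv : ((ℓ : ℕ) : NumberField.RingOfIntegers K) ∈ v.asIdeal), (Literature.NumberTheory.PAdicHodge.fontainePstAdicCompletion v ℓ hv).IsDeRhamFramed (ρ.toLocal v)) → (¬ ∃ χ : Literature.NumberTheory.GaloisRepresentations.FramedGaloisRep K (PadicAlgCl ℓ) 1, ∀ σ, (ρ σ⁻¹).val.trace = (χ σ).val 0 0 * (ρ σ).val.trace) → ∃ π : Literature.NumberTheory.Automorphic.CuspidalAutomorphicRepData 3 K hcpt, π.1.IsLAlgebraic ∧ ∀ᶠ v : IsDedekindDomain.HeightOneSpectrum (NumberField.RingOfIntegers K) in Filter.cofinite, Summit.Langlands.SatakeFrobCompatibleAt ι π.1 ρ v) : ¬ _root_.Langlands :=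
  fun hL ↦ h (rcs_stubNonSelfDualRankThreeAutomorphy_of_langlands hL)

/-- **stub LGC (`stub_pairCompatibility`, every `𝓡`) is summit-implied**: (A) gives a corresponding avatar
`ρ₀` (LGC at every `v`); `ρ` and `ρ₀` are irreducible hence semisimple, have equal Satake parameters a.e.
(`hasSatakeParamAt_unique_holds`), hence equal Frobenius polynomials a.e., hence are equivalent (Chebotarev +
Brauer–Nesbitt, `nonempty_equiv_of_hasFrobCharpolyAt_eventually`), hence `ρ = P ρ₀ P⁻¹`
(`exists_eq_conj_of_equiv`), and `Corresponds` is invariant under change of frame (`corresponds_conj`,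
landed for crux 14328). [folklore] -/
theorem rcs_stubPairCompatibility_of_langlands (hL : _root_.Langlands) : ∀ (K : Type) [Field K] [NumberField K] (𝓡 : Summit.Langlands.ReciprocityData K) (n : ℕ) (hcpt : Literature.NumberTheory.Automorphic.isCompact_glFiniteIntegralLevel n K), 0 < n → ∀ (π : Literature.NumberTheory.Automorphic.CuspidalAutomorphicRepData n K hcpt), π.1.IsLAlgebraic → ∀ (ℓ : ℕ) [Fact ℓ.Prime] (ι : PadicAlgCl ℓ ≃+* ℂ) (ρ : Literature.NumberTheory.GaloisRepresentations.FramedGaloisRep K (PadicAlgCl ℓ) n), ρ.toGaloisRep.IsIrreducible → ((∀ᶠ v : IsDedekindDomain.HeightOneSpectrum (NumberField.RingOfIntegers K) in Filter.cofinite, ρ.IsUnramifiedAt v) ∧ ∀ (v : IsDedekindDomain.HeightOneSpectrum (NumberField.RingOfIntegers K)) (hv : ((ℓ : ℕ) : NumberField.RingOfIntegers K) ∈ v.asIdeal), (Literature.NumberTheory.PAdicHodge.fontainePstAdicCompletion v ℓ hv).IsDeRhamFramed (ρ.toLocal v)) → (∀ᶠ v : IsDedekindDomain.HeightOneSpectrum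 (NumberField.RingOfIntegers K) in Filter.cofinite, Summit.Langlands.SatakeFrobCompatibleAt ι π.1 ρ v) → ∀ v : IsDedekindDomain.HeightOneSpectrum (NumberField.RingOfIntegers K), Summit.Langlands.LocalGlobalCompatibleAt 𝓡 ι π.1 ρ v := by
  intro K _ _ 𝓡 n hcpt hn π hLalg ℓ _ ι ρ hirr _hgeo hsat v
  obtain ⟨-, h⟩ := hL K
  obtain ⟨ρ₀, hirr₀, -, hcorr₀, -⟩ := (h 𝓡 n hn hcpt).1 π hLalg ℓ ι
  have hs0 : ρ₀.toGaloisRep.IsSemisimple := by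
    haveI := hirr₀
    change ComplementedLattice _
    infer_instance
  have hs : ρ.toGaloisRep.IsSemisimple := by
    haveI := hirr
    change ComplementedLattice _
    infer_instance
  have hev : ∀ᶠ v : IsDedekindDomain.HeightOneSpectrum (NumberField.RingOfIntegers K) in Filter.cofinite,
      ρ₀.IsUnramifiedAt v ∧ ρ.IsUnramifiedAt v ∧
        ∃ P : Polynomial (PadicAlgCl ℓ), ρ₀.HasFrobCharpolyAt v P ∧ ρ.HasFrobCharpolyAt v P := by
    filter_upwards [hcorr₀.1, hsat] with v hv hv'
    obtain ⟨α, hα, hur, hcp⟩ := hv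
    obtain ⟨α', hα', hur', hcp'⟩ := hv'
    obtain rfl : α = α' := AutomorphicRepData.hasSatakeParamAt_unique_holds π.1 hα hα'
    exact ⟨hur, hur', _, hcp, hcp'⟩
  obtain ⟨e⟩ := FramedGaloisRep.nonempty_equiv_of_hasFrobCharpolyAt_eventually
    chebotarev_artinRep_holds ρ₀ ρ hs0 hs hev
  obtain ⟨P, hP⟩ := FramedRep.exists_eq_conj_of_equiv ρ₀ ρ e
  have hc : Summit.Langlands.Corresponds 𝓡 ι π.1 (FramedRep.conj P ρ₀) :=
    Summit.Langlands.Langlands.Theorems.ReciprocityUpToIrreducibility.corresponds_conj 𝓡 ι π.1 P hcorr₀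
  rw [← hP] at hc
  exact hc.2 v

/-- … so an a.e.-compatible irreducible pair `(π, ρ)` with a local mismatch at some finite place, for some
pinned reciprocity datum, refutes the formal summit. [folklore] -/
theorem rcs_not_langlands_of_not_stubPairCompatibility (h : ¬ ∀ (K : Type) [Field K] [NumberField K] (𝓡 : Summit.Langlands.ReciprocityData K) (n : ℕ) (hcpt : Literature.NumberTheory.Automorphic.isCompact_glFiniteIntegralLevel n K), 0 < n → ∀ (π : Literature.NumberTheory.Automorphic.CuspidalAutomorphicRepData n K hcpt), π.1.IsLAlgebraic → ∀ (ℓ : ℕ) [Fact ℓ.Prime] (ι : PadicAlgCl ℓ ≃+* ℂ) (ρ : Literature.NumberTheory.GaloisRepresentations.FramedGaloisRep K (PadicAlgCl ℓ) n), ρ.toGaloisRep.IsIrreducible → ((∀ᶠ v : IsDedekindDomain.HeightOneSpectrum (NumberField.RingOfIntegers K) in Filter.cofinite, ρ.IsUnramifiedAt v) ∧ ∀ (v : IsDedekindDomain.HeightOneSpectrum (NumberField.RingOfIntegers K)) (hv : ((ℓ : ℕ) : NumberField.RingOfIntegers K) ∈ v.asIdeal), (Literature.NumberTheory.PAdicHodge.fontainePstAdicCompletion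 v ℓ hv).IsDeRhamFramed (ρ.toLocal v)) → (∀ᶠ v : IsDedekindDomain.HeightOneSpectrum (NumberField.RingOfIntegers K) in Filter.cofinite, Summit.Langlands.SatakeFrobCompatibleAt ι π.1 ρ v) → ∀ v : IsDedekindDomain.HeightOneSpectrum (NumberField.RingOfIntegers K), Summit.Langlands.LocalGlobalCompatibleAt 𝓡 ι π.1 ρ v) : ¬ _root_.Langlands :=
  fun hL ↦ h (rcs_stubPairCompatibility_of_langlands hL)

/-- **stub RD (`stub_reciprocityData`) is the summit's first conjunct.** [folklore] -/
theorem rcs_stubReciprocityData_of_langlands (hL : _root_.Langlands) :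
    ∀ (K : Type) [Field K] [NumberField K], Nonempty (Summit.Langlands.ReciprocityData K) :=
  fun K _ _ ↦ (hL K).1

/-- … so an EMPTY `ReciprocityData K` (an unsatisfiable `LocalLanglandsDatum (K_v)` as typed) refutes the
formal summit — the Statement's own fail-safe. [folklore] -/
theorem rcs_not_langlands_of_not_stubReciprocityData
    (h : ¬ ∀ (K : Type) [Field K] [NumberField K], Nonempty (Summit.Langlands.ReciprocityData K)) :
    ¬ _root_.Langlands :=
  fun hL ↦ h (rcs_stubReciprocityData_of_langlands hL)

end RamifiedCoefficientSeed

end Summit.Langlands.Langlands.Cruxes.SectorComplement.Disproof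

/-!
# PART IV — Disproof of `EisensteinDegreeShift.SectorComplement` — findings (crux stmt-Langlands-18372)

Seat refuter-cdisprove-stmt-Langlands-18372-0 (cdisprove, cycle 1, 2026-08-17), route
`route-Langlands-EisensteinDegreeShift` rev 1 (`eds_` prefix, section `EisensteinDegreeShift`).  Extra imports
this part adds at the top of the shared file: the route file, `Theses.PrimeSwitchSplit` (the registered
line's stubs 2–6 are VERBATIM its items and its `closes` is reused), nothing else new
(`…ReciprocityUpToIrreducibilityCorrespondsConj`, `PadicAlgClEquivComplex`, `GLnAdelicStructureProofs` were
already imported by PART III).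

ITEM. `SectorComplement : Prop := BorelFLReciprocity → _root_.Langlands` (crux rank 9, the route's declared
RESIDUAL JUNCTION: "THE REST OF THE SUMMIT along this line … conjecture-grade, implied by the summit, never
staffed from this route").  Write X := `BorelFLReciprocity` (target, stmt-18368: clause (B) in a.e.-Satake
form on the sector K CM, `2 ≤ n < p`, `p` unramified, `ρ` irreducible, a.e. unramified, residually Borel
integral model, crystalline for the pinned datum with `n` distinct labelled weights of spread `≤ p − 2`),
C the item, S := `_root_.Langlands`, B_w := `PrimeSwitchSplit.WeakGeometricAutomorphy` (weak (B) for every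
`K`, `n ≥ 1`, `ℓ`).  Prior art on THIS decl, read and not redone: `Rattack_EisensteinDegreeShift.lean` /
`RATTACK_…md` (crux-attack at birth: survives; `¬C ↔ X ∧ ¬S`, `S → X`, `(C → S) ↔ X`),
`Position_EisensteinDegreeShift.lean` + `EQUIVALENCE-AUDIT_…md` (strategist: equivalence-benign, BC7 5/5 CLEAN,
implication probes), `PROBE-RESULTS_…md` / `VET-birth_…md` (registered line, 6 stubs, 12/12 stub→C/S probes
fail), PARTS I–III of this file (same pattern for three sibling junctions).  The rattack seat's Negative-lane
copy p169529 BOUNCED on an infrastructure probe (farm rc 75) and was never resubmitted; this seat lands the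
position lemmas afresh (`Theorems/SectorComplement/Negative/EisensteinDegreeShiftSectorComplementPosition.lean`).

VERDICT (cycle 1): NO KILL, and none exists short of refuting the audited summit.  Kernel-checked below:

* §E1 position — `eds_not_sectorComplement_iff : ¬C ↔ X ∧ ¬S`; `S → C` is `fun h _ ↦ h`.
* §E2 containment THROUGH B_w — `eds_weakB_of_langlands : S → B_w`, `eds_target_of_weakB : B_w → X` (the
  sector's CM / `2 ≤ n < p` / `p`-unramified / `O` / Borel-model / weight hypotheses are DISCARDED;
  irreducible + a.e.-unramified kept; crystalline ⇒ de Rham by `IsCrystallineFramed.isDeRhamFramed`), hence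
  `S → X`, `¬X → ¬B_w → ¬S` is how a counterexample in the sector would propagate (it refutes Fontaine–Mazur
  and PROVES C ex falso), and the exact identities `S ↔ X ∧ C`, `(C → S) ↔ X`.
* §E3 load-bearing / tightness — C has ONE hypothesis, X; `EdsSectorComplementWithoutTarget := S`
  (`…_iff : ↔ X ∧ C`): the protocol's `_false_without_X` lemma would be `¬S`, unavailable.  TIGHTNESS:
  C is the WEAKEST proposition J with `X ∧ J → S` (`eds_sectorComplement_weakest`), so no cheaper junction
  closes the route; under S1 S2 S3 (`closes`) `C ↔ S` and X holds (`eds_target_of_cruxes`).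
* §E4 debts — what a proof of C must deliver and X does not touch: `Nonempty (ReciprocityData K)` for every
  K, direction (A) for every `K, 𝓡, n ≥ 1`, direction (B) with local–global compatibility at EVERY finite
  place for every `K, 𝓡, n ≥ 1, ℓ` (projections `eds_sectorComplement_reciprocityData / _directionA /
  _directionB`).  X is (B)-weak on one sector: it supplies no (A), no LGC, no `𝓡`.
* §E5 natural strengthenings / junk models — NONE refutable in the tree: every strengthening `X⁺ → S` with
  `X → X⁺` is sandwiched `S → (X⁺ → S) → C` (`eds_strengthening_of_langlands`), and refuting ANY implication
  needs its antecedent PROVED (`eds_not_imp_iff`) — X, X⁺ are open and not junk-provable (BC7 P1/P2/P3 CLEAN;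
  the cuspidal conclusion type has no junk inhabitant; vacuity of X's hypotheses is not provable short of
  `¬FontaineDatumExists`, the summit's own AMBER-4 pin).  C has no binders: no degenerate instance, finite
  model, quantifier-order or normalisation attack exists AT C.  `ledger negatives --problem Langlands`: the
  `n = 0` junk refutations (16822, 17212) would bite only a consequent WITHOUT `0 < n`, and even then only
  given a proof of X.  kit: nothing finite to compute.
* §E6 `-- Targets` = the REGISTERED line `Lines/birth_EisensteinDegreeShift.lean` (sha 21d10751…, 6 stubs;
  payload targets/stuck_stubs empty, no PICKED.md for this route).  Findings: (i) stub 1 is literally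
  `X → B_w` (`eds_lineStub1_iff`, `Iff.rfl` on the verbatim text) and stubs 2–6 are by name the PrimeSwitchSplit
  items `SatakeAvatarExistence` (17415), `PadicMemberCompatibility` (17534), `CompatibilityAwayFromLR` (18084),
  `CanonicalReciprocityData` (17930), `AvatarConjugacy` (17844) — so THE LINE IS ROUTE PrimeSwitchSplit WITH
  ITS RANK-2 CRUX B_w WEAKENED TO "B_w GRANTED X": `eds_sectorComplement_of_lineStubs` is one line through
  `PrimeSwitchSplit.closes`, and `eds_langlands_iff_target_and_lineStubs : S ↔ X ∧ stub₁ ∧ … ∧ stub₆`;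
  (ii) EVERY stub is summit-implied (`eds_lineStub1_of_langlands`, `eds_satakeAvatarExistence_of_langlands`,
  `eds_padicMemberCompatibility_of_langlands` — (A) + Chebotarev/Brauer–Nesbitt conjugacy + transport of
  pinned geometricity and of `Corresponds` along conjugation, `eds_compatibilityAwayFromLR_of_langlands` —
  weak-to-strong upgrade `corresponds_of_exists_corresponds`, `eds_canonicalReciprocityData_of_langlands`),
  so NO STUB IS KILLABLE WITHOUT REFUTING THE SUMMIT (`eds_not_langlands_of_not_*`); (iii) stub 6 is a
  THEOREM now (`eds_avatarConjugacy_holds`, one line from the landed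
  `ReciprocityUpToIrreducibility.isConjugate_of_satakeFrobCompatibleAt`, p119850 — cone guardrail on 17844
  noted, nothing filed); (iv) costume test of stub 1: `(stub₁ → B_w) ↔ X` (`eds_lineStub1_imp_weakB_iff_target`)
  — "granted the sector" is a genuine weakening of B_w exactly to the extent X is open, the same status as
  `(C → S) ↔ X`; stub 1 stays summit-SCALE (Fontaine–Mazur–Langlands for every K, n off one sector).
  Nothing on the line is a disprover's target; the lead's progress on it IS progress on PrimeSwitchSplit.

No `sorry` in this part.  Nothing here asserts C, X, S1–S3 or the summit; `eds_avatarConjugacy_holds` is the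
one positive statement (a support item of another route, provable-now per its own docstring).
-/

namespace Summit.Langlands.Langlands.Cruxes.SectorComplement.Disproof

section EisensteinDegreeShift

open Summit.Langlands.Langlands.Theses.EisensteinDegreeShift
open Summit.Langlands.Langlands.Theses.PrimeSwitchSplit (WeakGeometricAutomorphy SatakeAvatarExistence
  PadicMemberCompatibility CompatibilityAwayFromLR CanonicalReciprocityData AvatarConjugacy)
open Summit.Langlands.Langlands.Theorems.ReciprocityUpToIrreducibility
open Literature.NumberTheory.GaloisRepresentations Literature.NumberTheory.Automorphic
open Summit.Langlands

/-! ## §E1 Logical position of the junction -/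

/-- Readback: the crux is by definition `X → S`. [folklore] -/
theorem eds_sectorComplement_iff_imp :
    SectorComplement ↔ (BorelFLReciprocity → _root_.Langlands) :=
  Iff.rfl

/-- `S → C` (discard the sector hypothesis): the junction is summit-implied by design. [folklore] -/
theorem eds_sectorComplement_of_langlands : _root_.Langlands → SectorComplement :=
  fun h _ ↦ h

/-- Truth table `C ↔ ¬X ∨ S`. [folklore] -/
theorem eds_sectorComplement_iff_not_or :
    SectorComplement ↔ ¬ BorelFLReciprocity ∨ _root_.Langlands :=
  imp_iff_not_or

/-- **Exact content of a refutation**: `¬C ↔ X ∧ ¬S`. [folklore] -/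
theorem eds_not_sectorComplement_iff :
    ¬ SectorComplement ↔ BorelFLReciprocity ∧ ¬ _root_.Langlands :=
  Classical.not_imp

/-- `¬C → ¬S`: the junction is never stronger than the summit. [folklore] -/
theorem eds_not_langlands_of_not_sectorComplement (h : ¬ SectorComplement) : ¬ _root_.Langlands :=
  (eds_not_sectorComplement_iff.mp h).2

/-- Under the target, `C ↔ S`. [folklore] -/
theorem eds_sectorComplement_iff_langlands_of_target (hX : BorelFLReciprocity) :
    SectorComplement ↔ _root_.Langlands :=
  ⟨fun hC ↦ hC hX, fun h _ ↦ h⟩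

/-! ## §E2 The sector is inside the summit — through weak (B) -/

/-- `S → B_w`: direction (B) of the summit gives weak (a.e.-Satake) automorphy of every irreducible
pinned-geometric `ρ`, every `K`, `n ≥ 1`, `ℓ` (`𝓡` from the non-vacuity conjunct; `Corresponds.1`).
[folklore] -/
theorem eds_weakB_of_langlands (hL : _root_.Langlands) : WeakGeometricAutomorphy := by
  intro K _ _ n hcpt hn ℓ _ ι ρ hirr hgeo
  obtain ⟨⟨𝓡⟩, h⟩ := hL K
  obtain ⟨π, hLalg, hcorr⟩ := (h 𝓡 n hn hcpt).2 ℓ ι ρ hirr ⟨hgeo.1, fun v hv ↦ hgeo.2 v hv⟩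
  exact ⟨π, hLalg, hcorr.1⟩

/-- **`B_w → X`: the sector theorem is a RESTRICTION of weak (B).**  Of X's hypotheses only
irreducibility, a.e.-unramifiedness and crystallinity (⇒ de Rham, `IsCrystallineFramed.isDeRhamFramed`)
are used; `IsCMField K`, `2 ≤ n < p` (beyond `0 < n`), `p` unramified, `O`, the residually-Borel model
`ρ₀` and the labelled-weight clause are discarded. [folklore] -/
theorem eds_target_of_weakB (hB : WeakGeometricAutomorphy) : BorelFLReciprocity := by
  intro K _ _ _hK n hn p _ _hp _hur O _hO hcpt ι ρ ρ₀ hirr hae _hut hFL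
  exact hB K n hcpt (by omega) p ι ρ hirr ⟨hae, fun v hv ↦ (hFL v hv).1.isDeRhamFramed⟩

/-- `S → X`: the sector is inside the summit as typed. [folklore] -/
theorem eds_target_of_langlands (hL : _root_.Langlands) : BorelFLReciprocity :=
  eds_target_of_weakB (eds_weakB_of_langlands hL)

/-- `¬X → ¬B_w`: a counterexample to reciprocity in the Borel–FL sector is a counterexample to weak (B) …
[folklore] -/
theorem eds_not_weakB_of_not_target (hX : ¬ BorelFLReciprocity) : ¬ WeakGeometricAutomorphy :=
  fun hB ↦ hX (eds_target_of_weakB hB)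

/-- … and to the formal summit (`¬X → ¬S`). [folklore] -/
theorem eds_not_langlands_of_not_target (hX : ¬ BorelFLReciprocity) : ¬ _root_.Langlands :=
  fun hL ↦ hX (eds_target_of_langlands hL)

/-- **Exact bookkeeping identity** `S ↔ X ∧ C`: target and junction partition the summit with no typing
drift. [folklore] -/
theorem eds_langlands_iff_target_and_sectorComplement :
    _root_.Langlands ↔ BorelFLReciprocity ∧ SectorComplement :=
  ⟨fun h ↦ ⟨eds_target_of_langlands h, fun _ ↦ h⟩, fun h ↦ h.2 h.1⟩

/-- `¬X → C ∧ ¬S`: a failure of the target PROVES the junction (ex falso) and refutes the summit — it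
never refutes the junction. [folklore] -/
theorem eds_sectorComplement_of_not_target (hX : ¬ BorelFLReciprocity) :
    SectorComplement ∧ ¬ _root_.Langlands :=
  ⟨fun h ↦ (hX h).elim, eds_not_langlands_of_not_target hX⟩

/-! ## §E3 Load-bearing analysis (one hypothesis, X) and tightness of the junction -/

/-- The junction with its only hypothesis dropped is the summit itself; the protocol's
`_false_without_target` lemma would be `¬ Langlands` and is deliberately not stated. [folklore] -/
def EdsSectorComplementWithoutTarget : Prop := _root_.Langlands

/-- Dropping the hypothesis costs exactly the target: `C-without-X ↔ X ∧ C`. [folklore] -/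
theorem eds_sectorComplementWithoutTarget_iff :
    EdsSectorComplementWithoutTarget ↔ BorelFLReciprocity ∧ SectorComplement :=
  eds_langlands_iff_target_and_sectorComplement

/-- **Restates-summit probe, settled**: `(C → S) ↔ X` — the junction is "the summit in a costume" exactly
iff the open sector theorem is provable. [folklore] -/
theorem eds_sectorComplement_imp_langlands_iff_target :
    (SectorComplement → _root_.Langlands) ↔ BorelFLReciprocity :=
  ⟨fun h ↦ Classical.byContradiction fun hX ↦ hX (eds_target_of_langlands (h fun x ↦ (hX x).elim)),
    fun hX hC ↦ hC hX⟩

/-- **Tightness: the junction is the WEAKEST closing proposition.**  For every `J`,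
`(X ∧ J → S) ↔ (J → C)`: any `J` that closes the summit together with the target already implies C, so
no cheaper junction exists for this route shape. [folklore] -/
theorem eds_sectorComplement_weakest (J : Prop) :
    (BorelFLReciprocity ∧ J → _root_.Langlands) ↔ (J → SectorComplement) :=
  ⟨fun h hJ hX ↦ h ⟨hX, hJ⟩, fun h hXJ ↦ h hXJ.2 hXJ.1⟩

/-- … in particular any `J` with a deciding theorem of the route's shape `S1 → S2 → S3 → J → S` implies C
once S1, S2, S3 hold. [folklore] -/
theorem eds_sectorComplement_of_junction {J : Prop}
    (hJ : EisensteinSteinbergSeed → EisensteinSeededLifting → SolubleDescentGLn → J → _root_.Langlands)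
    (h₁ : EisensteinSteinbergSeed) (h₂ : EisensteinSeededLifting) (h₃ : SolubleDescentGLn) :
    J → SectorComplement :=
  fun j _ ↦ hJ h₁ h₂ h₃ j

/-- Under the route's three content items the target holds (the first ten lines of `closes`, recovered
here from `closes` and `(C → S) ↔ X`). [folklore] -/
theorem eds_target_of_cruxes (h₁ : EisensteinSteinbergSeed) (h₂ : EisensteinSeededLifting)
    (h₃ : SolubleDescentGLn) : BorelFLReciprocity :=
  eds_sectorComplement_imp_langlands_iff_target.mp (closes h₁ h₂ h₃)

/-- … hence under S1, S2, S3 the junction IS the summit: `C ↔ S`. [folklore] -/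
theorem eds_sectorComplement_iff_langlands_of_cruxes (h₁ : EisensteinSteinbergSeed)
    (h₂ : EisensteinSeededLifting) (h₃ : SolubleDescentGLn) : SectorComplement ↔ _root_.Langlands :=
  ⟨closes h₁ h₂ h₃, fun h _ ↦ h⟩

/-! ## §E4 Debts: what a proof of the junction must deliver beyond the target -/

/-- Debt 1 — reciprocity data for EVERY number field (the summit's non-vacuity conjunct). [folklore] -/
theorem eds_sectorComplement_reciprocityData (hC : SectorComplement) (hX : BorelFLReciprocity)
    (K : Type) [Field K] [NumberField K] : Nonempty (ReciprocityData K) :=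
  (hC hX K).1

/-- Debt 2 — direction (A) for every `K`, every pinned datum `𝓡`, every `n ≥ 1` (Galois representations
attached to ALL L-algebraic cuspidal `π`, irregular ones included, with local–global compatibility at every
finite place and uniqueness); X says nothing automorphic-to-Galois. [folklore] -/
theorem eds_sectorComplement_directionA (hC : SectorComplement) (hX : BorelFLReciprocity)
    (K : Type) [Field K] [NumberField K] (𝓡 : ReciprocityData K) (n : ℕ) (hn : 0 < n)
    (hcpt : isCompact_glFiniteIntegralLevel n K) : AutomorphicToGalois n 𝓡 hcpt :=
  ((hC hX K).2 𝓡 n hn hcpt).1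

/-- Debt 3 — direction (B) with local–global compatibility at EVERY finite place, for every `K` (non-CM
included), `𝓡`, `n ≥ 1` (`n = 1` and `n ≥ p` included), `ℓ` (ramified, small), every irreducible
pinned-geometric `ρ` (residually irreducible, de Rham non-crystalline, irregular weights included); X is
(B)-WEAK on one sector only. [folklore] -/
theorem eds_sectorComplement_directionB (hC : SectorComplement) (hX : BorelFLReciprocity)
    (K : Type) [Field K] [NumberField K] (𝓡 : ReciprocityData K) (n : ℕ) (hn : 0 < n)
    (hcpt : isCompact_glFiniteIntegralLevel n K) : GaloisToAutomorphic n 𝓡 hcpt :=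
  ((hC hX K).2 𝓡 n hn hcpt).2

/-! ## §E5 Natural strengthenings / junk models: none refutable in the tree -/

/-- Refuting ANY implication needs its antecedent proved: `¬(X' → S') ↔ X' ∧ ¬S'`. [folklore] -/
theorem eds_not_imp_iff (X' S' : Prop) : ¬ (X' → S') ↔ X' ∧ ¬ S' :=
  Classical.not_imp

/-- Every strengthening of the junction along its antecedent (`X⁺` weaker than X, e.g. X restricted to
`n = 2`, to `K` imaginary quadratic, to ordinary `ρ` …) is still summit-implied, hence irrefutable short of
`¬S`. [folklore] -/
theorem eds_strengthening_of_langlands {X' : Prop} (hL : _root_.Langlands) : X' → _root_.Langlands :=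
  fun _ ↦ hL

/-- … and sandwiched between S and C whenever `X → X⁺`. [folklore] -/
theorem eds_strengthening_sandwich {X' : Prop} (hXX' : BorelFLReciprocity → X') :
    (_root_.Langlands → (X' → _root_.Langlands)) ∧ ((X' → _root_.Langlands) → SectorComplement) :=
  ⟨fun hL _ ↦ hL, fun h hX ↦ h (hXX' hX)⟩

/-! ## §E6 Targets: the registered line `Lines/birth_EisensteinDegreeShift.lean` (6 stubs) -/

/-- Stub 1 of the registered line, VERBATIM (`stub_weakAutomorphyFromBorelFL`: "B_w granted the Borel–FL
sector"). [folklore] -/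
def EdsLineStub1 : Prop :=
  BorelFLReciprocity → ∀ (K : Type) [Field K] [NumberField K] (n : ℕ) (hcpt : Literature.NumberTheory.Automorphic.isCompact_glFiniteIntegralLevel n K), 0 < n → ∀ (ℓ : ℕ) [Fact ℓ.Prime] (ι : PadicAlgCl ℓ ≃+* ℂ) (ρ : Literature.NumberTheory.GaloisRepresentations.FramedGaloisRep K (PadicAlgCl ℓ) n), ρ.toGaloisRep.IsIrreducible → ((∀ᶠ v : IsDedekindDomain.HeightOneSpectrum (NumberField.RingOfIntegers K) in Filter.cofinite, ρ.IsUnramifiedAt v) ∧ ∀ (v : IsDedekindDomain.HeightOneSpectrum (NumberField.RingOfIntegers K)) (hv : ((ℓ : ℕ) : NumberField.RingOfIntegers K) ∈ v.asIdeal), (Literature.NumberTheory.PAdicHodge.fontainePstAdicCompletion v ℓ hv).IsDeRhamFramed (ρ.toLocal v)) → ∃ π : Literature.NumberTheory.Automorphic.CuspidalAutomorphicRepData n K hcpt, π.1.IsLAlgebraic ∧ ∀ᶠ v : IsDedekindDomain.HeightOneSpectrum (NumberField.RingOfIntegers K) in Filter.cofinite, SatakeFrobCompatibleAt ι π.1 ρ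 v

/-- Stub 1 is literally `X → B_w` (`B_w = PrimeSwitchSplit.WeakGeometricAutomorphy`, stmt-17414).
[folklore] -/
theorem eds_lineStub1_iff : EdsLineStub1 ↔ (BorelFLReciprocity → WeakGeometricAutomorphy) :=
  Iff.rfl

/-- Stub 1 is summit-implied (X unused). [folklore] -/
theorem eds_lineStub1_of_langlands (hL : _root_.Langlands) : EdsLineStub1 :=
  fun _ ↦ eds_weakB_of_langlands hL

/-- … so a counterexample to stub 1 refutes the formal summit. [folklore] -/
theorem eds_not_langlands_of_not_lineStub1 (h : ¬ EdsLineStub1) : ¬ _root_.Langlands :=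
  fun hL ↦ h (eds_lineStub1_of_langlands hL)

/-- **Costume test of stub 1**: `(stub₁ → B_w) ↔ X` — "B_w granted the sector" is a genuine weakening of
B_w exactly to the extent the sector theorem is open (compare `(C → S) ↔ X`). [folklore] -/
theorem eds_lineStub1_imp_weakB_iff_target :
    (EdsLineStub1 → WeakGeometricAutomorphy) ↔ BorelFLReciprocity :=
  ⟨fun h ↦ Classical.byContradiction fun hX ↦ hX (eds_target_of_weakB (h fun x ↦ (hX x).elim)),
    fun hX h1 ↦ h1 hX⟩

/-- Stub 2 (`stub_satakeAvatarExistence` = `PrimeSwitchSplit.SatakeAvatarExistence`, stmt-17415) is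
summit-implied: (A) gives an irreducible corresponding `ρ`; keep `Corresponds.1`. [folklore] -/
theorem eds_satakeAvatarExistence_of_langlands (hL : _root_.Langlands) : SatakeAvatarExistence := by
  intro K _ _ n hcpt hn π hLalg ℓ _ ι
  obtain ⟨⟨𝓡⟩, h⟩ := hL K
  obtain ⟨ρ, hirr, -, hcorr, -⟩ := (h 𝓡 n hn hcpt).1 π hLalg ℓ ι
  exact ⟨ρ, hirr, hcorr.1⟩

/-- … so a counterexample to stub 2 refutes the formal summit. [folklore] -/
theorem eds_not_langlands_of_not_satakeAvatarExistence (h : ¬ SatakeAvatarExistence) :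
    ¬ _root_.Langlands :=
  fun hL ↦ h (eds_satakeAvatarExistence_of_langlands hL)

/-- Stub 3 (`stub_padicMemberCompatibility` = `PrimeSwitchSplit.PadicMemberCompatibility`, stmt-17534)
is summit-implied: (i) de Rham above `ℓ` — (A) gives an irreducible pinned-geometric corresponding `ρ₀`,
conjugate to `ρ` (Chebotarev + Brauer–Nesbitt, `isConjugate_of_satakeFrobCompatibleAt`), and pinned
geometricity transports along conjugation (`isGeometricFramed_of_isConjugate`; `𝓡.pst` IS the pinned
datum by definition); (ii) the prime-switch clause — for the datum `Rec` at hand, (A) gives SOME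
corresponding `ρ₁`, and the weak-to-strong upgrade `corresponds_of_exists_corresponds` gives
`Corresponds Rec ι π ρ`, in particular compatibility at `v` (the `ℓ'`-adic data are unused). [folklore] -/
theorem eds_padicMemberCompatibility_of_langlands (hL : _root_.Langlands) : PadicMemberCompatibility := by
  intro K _ _ n hcpt hn π hLalg ℓ _ ι ρ hirr hρ v hv
  obtain ⟨⟨𝓡⟩, h⟩ := hL K
  obtain ⟨ρ₀, hirr₀, hgeo₀, hcorr₀, -⟩ := (h 𝓡 n hn hcpt).1 π hLalg ℓ ι
  have hconj : IsConjugate ρ₀ ρ := isConjugate_of_satakeFrobCompatibleAt π.1 ι hirr₀ hcorr₀.1 hρ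
  refine ⟨(isGeometricFramed_of_isConjugate hgeo₀ hconj).2 v hv, ?_⟩
  intro Rec ℓ' _ ι' ρ' _ _ _ _
  obtain ⟨ρ₁, -, -, hcorr₁, -⟩ := (h Rec n hn hcpt).1 π hLalg ℓ ι
  exact (corresponds_of_exists_corresponds hirr hρ ⟨ρ₁, hcorr₁⟩).2 v

/-- … so a counterexample to stub 3 refutes the formal summit. [folklore] -/
theorem eds_not_langlands_of_not_padicMemberCompatibility (h : ¬ PadicMemberCompatibility) :
    ¬ _root_.Langlands :=
  fun hL ↦ h (eds_padicMemberCompatibility_of_langlands hL)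

/-- Stub 4 (`stub_compatibilityAwayFromLR` = `PrimeSwitchSplit.CompatibilityAwayFromLR`, stmt-18084) is
summit-implied, for EVERY datum `Rec` (the summit is `∀ 𝓡` since the 2026-08-16 re-type): weak-to-strong
upgrade from (A) at `Rec`; the pinned-geometric hypothesis and `v ∤ ℓ` are unused. [folklore] -/
theorem eds_compatibilityAwayFromLR_of_langlands (hL : _root_.Langlands) : CompatibilityAwayFromLR := by
  intro K _ _ Rec n hcpt hn π hLalg ℓ _ ι ρ hirr _hgeo hρ v _hv
  obtain ⟨ρ₁, -, -, hcorr₁, -⟩ := ((hL K).2 Rec n hn hcpt).1 π hLalg ℓ ι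
  exact (corresponds_of_exists_corresponds hirr hρ ⟨ρ₁, hcorr₁⟩).2 v

/-- … so a counterexample to stub 4 (e.g. a legal `ReciprocityData` off at a ramified generic class of a
realised pair) refutes the formal summit. [folklore] -/
theorem eds_not_langlands_of_not_compatibilityAwayFromLR (h : ¬ CompatibilityAwayFromLR) :
    ¬ _root_.Langlands :=
  fun hL ↦ h (eds_compatibilityAwayFromLR_of_langlands hL)

/-- Stub 5 (`stub_canonicalReciprocityData` = `PrimeSwitchSplit.CanonicalReciprocityData`, stmt-17930) is
the summit's first conjunct. [folklore] -/
theorem eds_canonicalReciprocityData_of_langlands (hL : _root_.Langlands) : CanonicalReciprocityData :=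
  fun F _ _ ↦ (hL F).1

/-- … so its failure (an unsatisfiable-as-typed `ReciprocityData F`) refutes the formal summit — the
Statement's own fail-safe direction. [folklore] -/
theorem eds_not_langlands_of_not_canonicalReciprocityData (h : ¬ CanonicalReciprocityData) :
    ¬ _root_.Langlands :=
  fun hL ↦ h (eds_canonicalReciprocityData_of_langlands hL)

/-- Stub 6 (`stub_avatarConjugacy` = `PrimeSwitchSplit.AvatarConjugacy`, stmt-17844) is a THEOREM of the
tree: one line from the landed `isConjugate_of_satakeFrobCompatibleAt` (p119850).  Unkillable. [folklore] -/
theorem eds_avatarConjugacy_holds : AvatarConjugacy :=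
  fun _K _ _ _n _hcpt π _ℓ _ ι _ρ₀ _ρ h₀ hρ₀ hρ ↦ isConjugate_of_satakeFrobCompatibleAt π.1 ι h₀ hρ₀ hρ

/-- **Joint sufficiency, and what the line IS**: the six stubs give the junction in ONE line through route
PrimeSwitchSplit's deciding theorem — stub 1 at X is B_w, stubs 2–6 are PrimeSwitchSplit's other five
items.  The registered line is route PrimeSwitchSplit with its rank-2 crux B_w weakened to "B_w granted X".
[folklore] -/
theorem eds_sectorComplement_of_lineStubs (s₁ : EdsLineStub1) (s₂ : SatakeAvatarExistence)
    (s₃ : PadicMemberCompatibility) (s₄ : CompatibilityAwayFromLR) (s₅ : CanonicalReciprocityData)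
    (s₆ : AvatarConjugacy) : SectorComplement :=
  fun hX ↦ Theses.PrimeSwitchSplit.closes (s₁ hX) s₂ s₃ s₄ s₅ s₆

/-- **The line partitions the summit exactly**: `S ↔ X ∧ stub₁ ∧ stub₂ ∧ stub₃ ∧ stub₄ ∧ stub₅ ∧ stub₆`
(`→`: §E2 and the summit-implied certificates; `←`: the composition and `S ↔ X ∧ C`).  No stub is junk,
none is refutable short of `¬S`, and jointly WITH X they are the summit — the honest reading of a residual
junction's line. [folklore] -/
theorem eds_langlands_iff_target_and_lineStubs :
    _root_.Langlands ↔ BorelFLReciprocity ∧ EdsLineStub1 ∧ SatakeAvatarExistence ∧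
      PadicMemberCompatibility ∧ CompatibilityAwayFromLR ∧ CanonicalReciprocityData ∧ AvatarConjugacy :=
  ⟨fun hL ↦ ⟨eds_target_of_langlands hL, eds_lineStub1_of_langlands hL,
      eds_satakeAvatarExistence_of_langlands hL, eds_padicMemberCompatibility_of_langlands hL,
      eds_compatibilityAwayFromLR_of_langlands hL, eds_canonicalReciprocityData_of_langlands hL,
      eds_avatarConjugacy_holds⟩,
    fun ⟨hX, s₁, s₂, s₃, s₄, s₅, s₆⟩ ↦ eds_sectorComplement_of_lineStubs s₁ s₂ s₃ s₄ s₅ s₆ hX⟩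

/-- … equivalently, granted stub 6 (a theorem) the open content of the line is exactly
`X ∧ B_w-granted-X ∧ W⁺ ∧ P ∧ L∤R ∧ RD`, and since `B_w → X` the first two conjuncts are jointly just
`B_w`: `S ↔ B_w ∧ W⁺ ∧ P ∧ L∤R ∧ RD` — the PrimeSwitchSplit partition, target-free. [folklore] -/
theorem eds_langlands_iff_primeSwitchSplit :
    _root_.Langlands ↔ WeakGeometricAutomorphy ∧ SatakeAvatarExistence ∧ PadicMemberCompatibility ∧
      CompatibilityAwayFromLR ∧ CanonicalReciprocityData :=
  ⟨fun hL ↦ ⟨eds_weakB_of_langlands hL, eds_satakeAvatarExistence_of_langlands hL,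
      eds_padicMemberCompatibility_of_langlands hL, eds_compatibilityAwayFromLR_of_langlands hL,
      eds_canonicalReciprocityData_of_langlands hL⟩,
    fun ⟨hB, s₂, s₃, s₄, s₅⟩ ↦ Theses.PrimeSwitchSplit.closes hB s₂ s₃ s₄ s₅ eds_avatarConjugacy_holds⟩

end EisensteinDegreeShift

end Summit.Langlands.Langlands.Cruxes.SectorComplement.Disproof
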